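import Mathlib
import Literature.MathematicalPhysics.QuantumFieldTheory.Balaban1983to89.T4CubeShellGradPartner
import Literature.MathematicalPhysics.QuantumFieldTheory.Balaban1983to89.T4CubeShellResponseStein
import Literature.Analysis.OperatorTheory.CombesThomasBanded

/-!
# Cube-shell conditioning X: the STEIN REDUCTION of the gradient-partner seed — the parent-in-class profile
`κ^E_P ≤ κ^∂_P`, the WALL FUNCTIONAL of the hard window, and the seed from ONE remaining uniform input

Landing edition «CubeShell X» of the ideation cell `ym-nodeO-ideate` (seat P1, lens «inside Bałaban»; memo
`memos/ROUTE-P1.md` §0y.41, companion 46 `memos/ROUTE-P1-SketchCubeShellX.lean`), over the landed modules I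
`T4CubeShellBlocks`, III `T4CubeShellResponseStein`, IV `T4CubeShellConditional`, VII `T4CubeShellProfile` (seat P8), VIII
`T4CubeShellProfileP`, IX `T4CubeShellGradPartner` of this directory and the tree's finite-dimensional Combes–Thomas
estimate `Literature.Analysis.OperatorTheory.combesThomas_banded`.  Module IX reduced the doubling barrier for the
windowed covariance profile to ONE seed on the covariances `Cov_K(F ∘ merge, C⁻¹·(∂_j f₁) ∘ merge)` of the conditional
CHILDREN against the normalised frozen-direction partials of the parent; its header named the shape of the missing
estimate: "an integration by parts on the window with boundary faces followed by a Combes–Thomas estimate for a banded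
positive matrix".  THIS FILE CARRIES THAT OUT as far as it goes and TYPES WHAT IS LEFT: every term of the seed except
ONE is discharged here, uniformly in the number `n` of coordinates, and the one left is a named functional of the
window — the WALL TERM.  Sorry-free; no `axiom`; no `instance`; no notation; modules I ∕ III ∕ IV ∕ VII ∕ VIII ∕ IX and
`combesThomas_banded` BY NAME, nothing restated.

WHAT IS TYPED HERE (printed ingredients: Brascamp–Lieb [BrascampLieb1976, Thm 4.1]; the Gaussian ∕ Gibbs integration by
parts `Cov(Ψ, ∂g) = ⟨∂Ψ⟩` [GlimmJaffe1987, §9.1 (9.1.32), §4.3] and its boundary-face form on a box [Spivak1965, Thm 4-13]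
(module III's `stein_faces`); the Combes–Thomas estimate [CombesThomas1973, §II]; the DLR structure of finite-range
specifications [FriedliVelenik2017, Lemma 6.7]; the profile recursion of [Martinelli1999, §2.4 Thm 2.7],
[MartinelliOlivieri1994]; the printed full-space analogue of the whole reduction is the Helffer–Sjöstrand representation
[HelfferSjostrand1994], [Ledoux2001, Prop. 6.2 p.190]):
* §1 the PARENT-IN-CLASS gradient-partner profile `kappaE 𝔖 P m` (`κ^E_P(m)`): module IX's `profileSetD` with the
  parent ALSO in `P` — the only child triples IX's step ever produces; `0 ≤ κ^E_P ≤ κ^∂_P`, least-bound form, antitone;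
  `side_boundE`, `kappaP_stepE` (`κ_P(M) ≤ λ⁻¹ (a G(m+2r)) 2R² κ^E_P(m)²` for closed `P`, `M > 2m + 3r`), `kappaE_barrier`
  (ONE seed `c A q κ^E_P(s₀) ≤ ρ` ⇒ `κ^E_P(s_j) ≤ ρ^{2^j} ∕ (c A q^{j+1})` along `s_{j+1} = 2s_j + 3r + 1`),
  `kappaP_barrier_of_gradSeedE`, `kappaE_seed_of_forall`, and the read-out `abs_cubeCov_le_of_nearGauss_gradSeedE` for one
  action in `𝔐_ε = NearGauss 𝔖 ε` (VIII §6) — for a `P ⊆ 𝔐_ε` parent the partner is NEAR-AFFINE (§5);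
* §0 ∕ §2 helpers: linearity of `cubeMean` ∕ `cubeCov`, Brascamp–Lieb with a degenerate radius (`abs_cubeCov_le₀`),
  directional derivatives `dD h w = ∂_w h`, `∇(u·z) = u`, `∇(∂_w g) = g_xx w` (`coordGradient_dD`);
* §3 THE WALL FUNCTIONAL `wallDefect g S w Ψ = ⟨∂_w Ψ⟩_K − ⟨Ψ ∂_w g⟩_K` of the window `K = [-S,S]ⁿ` — the defect of the
  Stein identity caused by the HARD wall; `cubeCov_dD_eq`: `Cov_K(Ψ, ∂_w g) = ⟨∂_w Ψ⟩_K − Wall_w(Ψ − ⟨Ψ⟩_K)` (exact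
  identity, no convexity); `wallDefect_single_mul_cubeMass`: on `[-S,S]^{m+1}`, `Wall_{e_l}(Ψ)·Z_K` IS the difference of
  the two face integrals of `Ψ e^{-g}` (module III `stein_faces`);
* §4 THE STEIN REDUCTION `abs_cubeCov_le_stein`: on `K` with `g_xx ≥ λ`, `|∇Φ| ≤ 1`, ANY `z₀` and ANY `w` with
  `g_xx(z₀) w = ∇G(z₀)`: `|Cov_K(Φ, G)| ≤ |⟨∂_w Φ⟩_K| + |Wall_w(Φ − ⟨Φ⟩_K)| + λ⁻¹(δ_G + δ_H)` where `δ_G`, `δ_H` bound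
  the oscillation over `K` of `∇G` and of `g_xx(·) w` (`G = (G − u·z) + (u·z − ∂_w g) + ∂_w g`, Brascamp–Lieb twice,
  §3 once); `exists_dir` (`g_xx(z₀)` is invertible);
* §5 the partner IS near-affine: `coordGradient_partner` (`∇G = C⁻¹ ·` inside-masked Hessian row `j` OF THE PARENT, by
  the symmetry of second partials), `partner_grad_osc` (`δ_G = C⁻¹ ε` for a `RowOsc ε` parent); `kappaE_seed_of_stein`:
  the seed ⇐ per child triple, SOME `(w, z₀, δ_H)` with (W1) `|⟨∂_w Φ⟩_K|` + (W2) `|Wall_w(Φ̃)|` + (W3)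
  `λ⁻¹(C⁻¹ε + δ_H)` `≤ ρ ∕ (c A q)`;
* §6 (W1) `≤ Σ_{k ∈ B} |w_k|` — the `ℓ¹`-MASS of the direction on the insert's support `B` (`abs_cubeMean_dD_le`:
  `|∂_w Φ| ≤ Σ_{k∈B}|w_k|` pointwise since `Φ` depends on `B` only with `|∇Φ| ≤ 1`); the crude (W3)
  `δ_H ≤ ‖w‖₁ ε` (`hessian_mulVec_osc`); `kappaE_seed_of_wall`;
* §7 (W1) AND (W3) DISCHARGED UNIFORMLY IN `n`: `ct_hessian` = `combesThomas_banded` for the Hessian of a class member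
  (pseudo-distance `d∕r`, `σ = λ`, off-diagonal entries `≤ R`, `≤ a` neighbours): `|(g_xx(z₀)⁻¹)_{ik}| ≤ (2∕λ) e^{−μ d(i,k)∕r}`
  whenever `R a (e^μ − 1) ≤ λ∕2`; `abs_dir_le_far` ∕ `ell1_far_le`: since `∇G(z₀)` is supported in `B_r(j)` with entries
  `≤ 1` (`partner_grad_support`, `partner_grad_abs_le`) and `d(B, j) > s₀ + r`, `Σ_{k∈B} |w_k| ≤ a²(2∕λ) e^{−μ s₀∕r}`;
  `sq_dir_le` (`λ²|w|² ≤ 1`), `sum_sq_dotProduct_le_banded` (banded Cauchy–Schwarz), `hessian_mulVec_osc_banded`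
  (`|(g_xx(z) − g_xx(z'))w|² ≤ a ε² |w|²` for `g ∈ 𝔐 ∩ RowOsc ε`), whence `δ_H = a ε ∕ λ` (`hessian_dir_osc_le`); and the
  FINAL FORM `kappaE_seed_of_wallCT`: for range `r ≥ 1`, `μ ≥ 0` with `R a (e^μ − 1) ≤ λ∕2` and `P ⊆ {RowOsc ε}`,
      `c A q κ^E_P(s₀) ≤ ρ`  ⇐  for every exact child triple, SOME base point `z₀` (with THE solving direction `w`) has
      `a²(2∕λ) e^{−μ s₀∕r} + |Wall_w(Φ − ⟨Φ⟩_K)| + λ⁻¹(C⁻¹ + a∕λ) ε ≤ ρ ∕ (c A q)`.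
  The first summand is driven to `0` by the seed scale `s₀` alone and the third by `ε` alone, with constants depending on
  `(λ, R, r, a)` only.  So, combined with `kappaE_barrier` and VIII's `condClosed_nearGauss`, the ENTIRE windowed
  decay estimate for one action in `𝔐_ε` is reduced to ONE input: a uniform bound on the wall term `Wall_w(Φ̃)` of the
  conditional children — i.e. on the `e^{-g}`-weighted flux of `Φ̃` through the faces `{z_l = ±S}` of the window in the
  Combes–Thomas-decaying direction `w = g_xx(z₀)⁻¹∇G(z₀)`.
THE LOCATED OBSTRUCTION (memo §0y.41: census and an explicit quadratic example; none of it is formalised or used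
here).  For the classes `𝔐`, `𝔐_ε` AS TYPED the wall term cannot be expected to be small uniformly over all boundary
fields `x` IN THE WINDOW: with non-dominant Hessian rows (`R∕λ` of the size of Bałaban's small-field constants) corner
boundary data can push the mode of a conditional child onto a face of `[-S,S]ⁿ`, and a dominance margin preventing this
is not reproduced under the iterated conditioning of the recursion.  Hence the remaining input is a genuine additional
hypothesis on the window model — in print it is avoided altogether by working WITHOUT a hard window (Helffer–Sjöstrand ∕
Witten-Laplacian representation on the whole space, [HelfferSjostrand1994], [Ledoux2001, Prop. 6.2]) — and this file
makes that the ONLY place where the windowed route and the printed full-space route differ.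
WHAT THIS FILE DOES NOT CLAIM.  (i) No seed is PROVED for `𝔐_ε`: the wall bound is a HYPOTHESIS of `kappaE_seed_of_wallCT`
and no uniform bound on `wallDefect` is asserted anywhere; (ii) the `ℓ¹` form `kappaE_seed_of_wall` keeps a
volume-dependent `‖w‖₁` and is superseded by §7; (iii) it is NOT shown that any effective action of a renormalisation
programme lies in some `𝔐_ε` (VIII's `RowOsc` is GLOBAL — window caveat); (iv) nothing here is an estimate on any density
of Bałaban's programme, nor a statement about [Balaban1987RG1] Thm 2 ∕ (0.31), nor about the cell's target (an inhabitant
of `B13TermWalkDataOneTorus.ExistsUniformAcrossSmall`): the model is the WINDOWED cube model with a GLOBAL Hessian bound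
and FINITE range; (v) no new literature fact is introduced: every cite tag names the printed source of an ingredient or
the printed analogue of a step, the proofs are ours.
-/

set_option autoImplicit false
namespace Literature.MathematicalPhysics.QuantumFieldTheory.Balaban1983to89.T4CubeShellSteinSeed

open MeasureTheory Set Matrix
open Literature.MathematicalPhysics.QuantumFieldTheory.Balaban1983to89.T4CubeShellConditional
open Literature.MathematicalPhysics.QuantumFieldTheory.Balaban1983to89.T4CubeShellDoubling
open Literature.MathematicalPhysics.QuantumFieldTheory.Balaban1983to89.T4CubePoincare
open Literature.MathematicalPhysics.QuantumFieldTheory.Balaban1983to89.T4CubeShellBlocks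
open Literature.MathematicalPhysics.QuantumFieldTheory.Balaban1983to89.T4CubeShellProfile
open Literature.MathematicalPhysics.QuantumFieldTheory.Balaban1983to89.T4CubeShellProfileP
open Literature.MathematicalPhysics.QuantumFieldTheory.Balaban1983to89.T4CubeShellGradPartner
open Literature.MathematicalPhysics.QuantumFieldTheory.Balaban1983to89.T4CubeShellResponseStein
open Literature.Probability.Distributions

variable {n : ℕ}

/-! ## §1 The parent-in-class gradient-partner profile `κ^E_P ≤ κ^∂_P`: the EXACT child triples of `P`-parents -/

section ProfileE

variable (𝔖 : Spec n) (P : ((Fin n → ℝ) → ℝ) → Prop)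

/-- The set of gradient-partner covariance values at separation `m` of the EXACT child triples of `P`-PARENTS
(with `0` adjoined): module IX's `profileSetD` with the parent ALSO required to satisfy `P` — the only child
triples the step `kappaP_stepD` ever produces (its parent carries `P f`).  For a perturbative class (`P ⊆ 𝔐_ε`) this
is what makes the partner `C⁻¹·(∂_j f₁) ∘ merge` NEAR-AFFINE: its gradient is the inside-masked Hessian column `j` OF
THE PARENT, which the child's own Hessian does not see (the shell direction is frozen).
[cite: Martinelli1999, §2.4 p.103 (Def. 2.6); FriedliVelenik2017, Lemma 6.7 (6.7); GlimmJaffe1987, Cor. 4.3.4 (proof)] -/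
def profileSetE (m : ℕ) : Set ℝ :=
  {t | t = 0 ∨ ∃ (lab : Fin n → Fin 3) (f f₁ f₂ : (Fin n → ℝ) → ℝ) (C : ℝ) (x : Fin n → ℝ) (j : Fin n)
      (F : (Fin n → ℝ) → ℝ) (A : Finset (Fin n)),
      𝔖.SideData lab f f₁ f₂ C ∧ x ∈ cube n 𝔖.S ∧ lab j = 1 ∧ P f ∧ P (condPot lab 𝔖.lam f₁ x) ∧ 𝔖.Obs F A ∧
        (∀ i ∈ A, lab i = 0) ∧ (∀ i ∈ A, m + 𝔖.r < 𝔖.d i j) ∧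
        t = |cubeCov (condPot lab 𝔖.lam f₁ x) 𝔖.S (fun z => F (merge lab x z))
              (fun z => C⁻¹ * coordGradient f₁ (merge lab x z) j)|}

/-- THE PARENT-IN-CLASS GRADIENT-PARTNER PROFILE `κ^E_P(m) := sup profileSetE 𝔖 P m`.
[cite: Martinelli1999, §2.4 p.103 (Def. 2.6); GlimmJaffe1987, Cor. 4.3.4 (proof)] -/
noncomputable def kappaE (m : ℕ) : ℝ := sSup (profileSetE 𝔖 P m)

/-- `0` is adjoined. [cite: Martinelli1999, §2.4 p.103 (Def. 2.6)] -/
theorem zero_mem_profileSetE (m : ℕ) : (0 : ℝ) ∈ profileSetE 𝔖 P m := Or.inl rfl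

/-- The profile set is nonempty. [cite: Martinelli1999, §2.4 p.103 (Def. 2.6)] -/
theorem profileSetE_nonempty (m : ℕ) : (profileSetE 𝔖 P m).Nonempty := ⟨0, zero_mem_profileSetE 𝔖 P m⟩

/-- `profileSetE ⊆ profileSetD` (forget that the parent is in `P`). [cite: Martinelli1999, §2.4 p.103 (Def. 2.6)] -/
theorem profileSetE_subset (m : ℕ) : profileSetE 𝔖 P m ⊆ profileSetD 𝔖 P m := by
  rintro t (rfl | ⟨lab, f, f₁, f₂, C, x, j, F, A, hD, hx, hj, -, hPc, hF, hA0, hA1, rfl⟩)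
  · exact zero_mem_profileSetD 𝔖 P m
  · exact Or.inr ⟨lab, f, f₁, f₂, C, x, j, F, A, hD, hx, hj, hPc, hF, hA0, hA1, rfl⟩

/-- The profile set is bounded above (through `profileSetD`). [cite: BrascampLieb1976, Thm 4.1] -/
theorem profileSetE_bddAbove (m : ℕ) : BddAbove (profileSetE 𝔖 P m) :=
  (profileSetD_bddAbove 𝔖 P m).mono (profileSetE_subset 𝔖 P m)

/-- `0 ≤ κ^E_P(m)`. [cite: Martinelli1999, §2.4 p.103 (Def. 2.6)] -/
theorem kappaE_nonneg (m : ℕ) : 0 ≤ kappaE 𝔖 P m :=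
  le_csSup (profileSetE_bddAbove 𝔖 P m) (zero_mem_profileSetE 𝔖 P m)

/-- **`κ^E_P ≤ κ^∂_P`** (hence `≤ κ_P ≤ κ`): a seed on `κ^∂_P` implies one on `κ^E_P`, never conversely.
[cite: Martinelli1999, §2.4 p.103 (Def. 2.6)] -/
theorem kappaE_le_kappaD (m : ℕ) : kappaE 𝔖 P m ≤ kappaD 𝔖 P m :=
  csSup_le_csSup (profileSetD_bddAbove 𝔖 P m) (profileSetE_nonempty 𝔖 P m) (profileSetE_subset 𝔖 P m)

/-- Every exact child covariance of a `P`-parent is bounded by `κ^E_P(m)`.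
[cite: Martinelli1999, §2.4 p.103 (Def. 2.6); GlimmJaffe1987, Cor. 4.3.4 (proof)] -/
theorem abs_childCov_le_kappaE {lab : Fin n → Fin 3} {f f₁ f₂ : (Fin n → ℝ) → ℝ} {C : ℝ}
    (hD : 𝔖.SideData lab f f₁ f₂ C) {x : Fin n → ℝ} (hx : x ∈ cube n 𝔖.S) {j : Fin n} (hj : lab j = 1)
    (hPf : P f) (hPc : P (condPot lab 𝔖.lam f₁ x)) {m : ℕ} {F : (Fin n → ℝ) → ℝ} {A : Finset (Fin n)}
    (hF : 𝔖.Obs F A) (hA0 : ∀ i ∈ A, lab i = 0) (hA1 : ∀ i ∈ A, m + 𝔖.r < 𝔖.d i j) :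
    |cubeCov (condPot lab 𝔖.lam f₁ x) 𝔖.S (fun z => F (merge lab x z))
        (fun z => C⁻¹ * coordGradient f₁ (merge lab x z) j)| ≤ kappaE 𝔖 P m :=
  le_csSup (profileSetE_bddAbove 𝔖 P m)
    (Or.inr ⟨lab, f, f₁, f₂, C, x, j, F, A, hD, hx, hj, hPf, hPc, hF, hA0, hA1, rfl⟩)

/-- **`κ^E_P(m)` is the LEAST bound of the exact child covariances of `P`-parents** — the pointwise form an in-situ
estimate supplies (§4–§5). [cite: Martinelli1999, §2.4 p.103 (Def. 2.6); GlimmJaffe1987, Cor. 4.3.4 (proof); BrascampLieb1976, Thm 4.1] -/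
theorem kappaE_le_of_forall {m : ℕ} {b : ℝ} (hb : 0 ≤ b)
    (h : ∀ (lab : Fin n → Fin 3) (f f₁ f₂ : (Fin n → ℝ) → ℝ) (C : ℝ) (x : Fin n → ℝ) (j : Fin n)
      (F : (Fin n → ℝ) → ℝ) (A : Finset (Fin n)),
      𝔖.SideData lab f f₁ f₂ C → x ∈ cube n 𝔖.S → lab j = 1 → P f → P (condPot lab 𝔖.lam f₁ x) → 𝔖.Obs F A →
        (∀ i ∈ A, lab i = 0) → (∀ i ∈ A, m + 𝔖.r < 𝔖.d i j) →
        |cubeCov (condPot lab 𝔖.lam f₁ x) 𝔖.S (fun z => F (merge lab x z))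
            (fun z => C⁻¹ * coordGradient f₁ (merge lab x z) j)| ≤ b) :
    kappaE 𝔖 P m ≤ b := by
  refine csSup_le (profileSetE_nonempty 𝔖 P m) ?_
  rintro t (rfl | ⟨lab, f, f₁, f₂, C, x, j, F, A, hD, hx, hj, hPf, hPc, hF, hA0, hA1, rfl⟩)
  · exact hb
  · exact h lab f f₁ f₂ C x j F A hD hx hj hPf hPc hF hA0 hA1

/-- `κ^E_P` is non-increasing in the separation. [cite: Martinelli1999, §2.4 p.103 (Def. 2.6)] -/
theorem kappaE_antitone : Antitone (kappaE 𝔖 P) := fun m _ hmm' =>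
  kappaE_le_of_forall 𝔖 P (kappaE_nonneg 𝔖 P m) fun _ _ _ _ _ _ _ _ _ hD hx hj hPf hPc hF hA0 hA1 =>
    abs_childCov_le_kappaE 𝔖 P hD hx hj hPf hPc hF hA0 fun i hi => lt_of_le_of_lt (by omega) (hA1 i hi)

/-- **The one-sided recursion bound with `κ^E_P`**: along one-sided data OF A `P`-PARENT, if the children satisfy `P`,
every shell-indexed conditional covariance is `≤ C · κ^E_P(m)` (module IX `side_boundD` with the parent recorded).
[cite: FriedliVelenik2017, Lemma 6.7 (6.7); FriedliVelenik2017, §6.10.1 (6.110); GlimmJaffe1987, Cor. 4.3.4 (proof); Martinelli1999, §2.4 p.103 (Def. 2.6)] -/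
theorem side_boundE {lab : Fin n → Fin 3} {f f₁ f₂ : (Fin n → ℝ) → ℝ} {C : ℝ} (hD : 𝔖.SideData lab f f₁ f₂ C)
    (hPf : P f) {m : ℕ} {F : (Fin n → ℝ) → ℝ} {A : Finset (Fin n)} (hF : 𝔖.Obs F A) (hA0 : ∀ i ∈ A, lab i = 0)
    (hA1 : ∀ j, lab j = 1 → ∀ i ∈ A, m + 𝔖.r < 𝔖.d i j)
    (hcl : ∀ x ∈ cube n 𝔖.S, P (condPot lab 𝔖.lam f₁ x)) :
    ∀ x ∈ cube n 𝔖.S, ∀ j, lab j = 1 →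
      |shellCov lab f₁ 𝔖.S F (fun y => coordGradient f₁ y j) x| ≤ C * kappaE 𝔖 P m := by
  intro x hx j hj
  have hκ := abs_childCov_le_kappaE 𝔖 P hD hx hj hPf (hcl x hx) hF hA0 (hA1 j hj)
  obtain ⟨hFc, -, hFd, -⟩ := hF
  have hC : C ≠ 0 := hD.C_pos.ne'
  have hFd2 : DependsOn F {i | lab i ≠ 2} := hFd.mono fun i hi => by
    have h := hA0 i (Finset.mem_coe.mp hi)
    show lab i ≠ 2
    rw [h]; decide
  rw [shellCov_grad_eq_cubeCov_condPot 𝔖.S_pos lab 𝔖.lam (hD.cd₁.of_le (by norm_num)) hFc.continuous hD.dep₁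
    hFd2 x j]
  have e : (fun z => coordGradient f₁ (merge lab x z) j)
      = fun z => C * (C⁻¹ * coordGradient f₁ (merge lab x z) j) := by
    funext z
    rw [← mul_assoc, mul_inv_cancel₀ hC, one_mul]
  rw [e, cubeCov_const_mul_right, abs_mul, abs_of_pos hD.C_pos]
  exact mul_le_mul_of_nonneg_left hκ hD.C_pos.le

/-- **THE STEP FROM `κ^E_P`**: for closed `P` and `M > 2m + 3r`, `κ_P(M) ≤ λ⁻¹ · (a · G(m + 2r)) · 2R² · κ^E_P(m)²`
(module IX `kappaP_stepD`, whose parent carries `P f`, with `side_boundE` on both sides).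
[cite: BrascampLieb1976, Thm 4.1; FriedliVelenik2017, Exercise 3.11 (3.26); GlimmJaffe1987, Cor. 4.3.4 (proof); Martinelli1999, §2.4 p.103 (Def. 2.6, Thm 2.7); MartinelliOlivieri1994] -/
theorem kappaP_stepE (hcl : CondClosed 𝔖 P) {m M : ℕ} (hM : 2 * m + 3 * 𝔖.r < M) :
    kappaP 𝔖 P M ≤ 𝔖.lam⁻¹ * ((𝔖.a * 𝔖.growth (m + 2 * 𝔖.r) : ℕ) : ℝ) * (2 * 𝔖.R ^ 2) * kappaE 𝔖 P m ^ 2 := by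
  have hlam := 𝔖.lam_pos
  have hκ := kappaE_nonneg 𝔖 P m
  refine kappaP_le_of_forall 𝔖 P (by positivity) fun f F H hAdm hPf => ?_
  obtain ⟨hfC, A, B, hF, hH, hsep⟩ := hAdm
  have hw : 𝔖.Wide (𝔖.rlab A m) := 𝔖.wide_rlab
  have hDlo := 𝔖.sideData_lo hfC hw
  have hDhi := 𝔖.sideData_hi hfC hw
  have hclo : ∀ x ∈ cube n 𝔖.S, P (condPot (𝔖.rlab A m) 𝔖.lam (fLo (𝔖.rlab A m) f) x) :=
    fun x hx => (hcl hw hfC hPf x hx).1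
  have hchi : ∀ x ∈ cube n 𝔖.S, P (condPot (lswap (𝔖.rlab A m)) 𝔖.lam (fHi (𝔖.rlab A m) f) x) :=
    fun x hx => (hcl hw hfC hPf x hx).2
  have hβ := side_boundE 𝔖 P hDlo hPf (m := m) hF (fun i hi => 𝔖.rlab_of_mem hi)
    (fun j hj => 𝔖.rlab_shell_far hj) hclo
  have hγ' := side_boundE 𝔖 P hDhi hPf (m := m) hH
    (fun k hk => (lswap_spec _ k).1.mpr (𝔖.rlab_of_sep hsep hM hk))
    (fun j hj => 𝔖.rlab_shell_far' hsep hM ((lswap_spec _ j).2.1.mp hj)) hchi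
  have hγ : ∀ x ∈ cube n 𝔖.S, ∀ j, 𝔖.rlab A m j = 1 →
      |shellCov (𝔖.rlab A m) (fHi (𝔖.rlab A m) f) 𝔖.S H (fun y => coordGradient (fHi (𝔖.rlab A m) f) y j) x|
        ≤ 𝔖.R * kappaE 𝔖 P m := by
    intro x hx j hj
    rw [← shellCov_lswap]
    exact hγ' x hx j ((lswap_spec _ j).2.1.mpr hj)
  have hB' : HessianBound (fLo (𝔖.rlab A m) f + fHi (𝔖.rlab A m) f) 𝔖.lam := by
    rw [fLo_add_fHi]; exact hfC.2.1
  have hFd : DependsOn F {i | 𝔖.rlab A m i = 0} :=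
    hF.2.2.1.mono fun i hi => 𝔖.rlab_of_mem (Finset.mem_coe.mp hi)
  have hHd : DependsOn H {i | 𝔖.rlab A m i = 2} :=
    hH.2.2.1.mono fun k hk => 𝔖.rlab_of_sep hsep hM (Finset.mem_coe.mp hk)
  have key := abs_cubeCov_le_doubling_profile 𝔖.S_pos 𝔖.lam_pos (𝔖.rlab A m) hDlo.cd₁ hDlo.cd₂ hB' hF.1 hH.1
    hDlo.dep₁ hFd hDlo.dep₂ hHd (κ₁ := kappaE 𝔖 P m) (κ₂ := kappaE 𝔖 P m) (C_F := 2 * 𝔖.R) (C_H := 𝔖.R) hκ hκ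
    (by have := 𝔖.R_pos; positivity) 𝔖.R_pos.le hβ hγ
  rw [fLo_add_fHi] at key
  have hN : (((Finset.univ.filter fun j => 𝔖.rlab A m j = 1).card : ℕ) : ℝ)
      ≤ ((𝔖.a * 𝔖.growth (m + 2 * 𝔖.r) : ℕ) : ℝ) := by
    have h1 := 𝔖.card_shell_le (A := A) (m := m)
    have h2 : A.card * 𝔖.growth (m + 2 * 𝔖.r) ≤ 𝔖.a * 𝔖.growth (m + 2 * 𝔖.r) :=
      Nat.mul_le_mul_right _ hF.2.2.2
    exact_mod_cast h1.trans h2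
  have hR := 𝔖.R_pos
  calc |cubeCov f 𝔖.S F H|
      ≤ 𝔖.lam⁻¹ * ((Finset.univ.filter fun j => 𝔖.rlab A m j = 1).card : ℝ) * (2 * 𝔖.R * 𝔖.R)
          * (kappaE 𝔖 P m * kappaE 𝔖 P m) := key
    _ ≤ 𝔖.lam⁻¹ * ((𝔖.a * 𝔖.growth (m + 2 * 𝔖.r) : ℕ) : ℝ) * (2 * 𝔖.R * 𝔖.R)
          * (kappaE 𝔖 P m * kappaE 𝔖 P m) := by gcongr
    _ = 𝔖.lam⁻¹ * ((𝔖.a * 𝔖.growth (m + 2 * 𝔖.r) : ℕ) : ℝ) * (2 * 𝔖.R ^ 2) * kappaE 𝔖 P m ^ 2 := by ring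

/-- **THE BARRIER FROM A PARENT-IN-CLASS GRADIENT-PARTNER SEED.**  For closed `P`, along `s_{j+1} = 2 s_j + 3r + 1` with
`a·G(s_j + 2r) ≤ A q^j`, ONE seed `c A q κ^E_P(s_0) ≤ ρ` (`c = 2R²∕λ`) gives `κ^E_P(s_j) ≤ ρ^{2^j} ∕ (c A q^{j+1})` for
all `j` (`κ^E_P ≤ κ^∂_P ≤ κ_P`, `kappaP_stepE`, `sq_barrier`).
[cite: Martinelli1999, §2.4 p.103 (Def. 2.6, Thm 2.7); MartinelliOlivieri1994; HelfferSjostrand1994; Ledoux2001, Prop. 6.2 p.190] -/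
theorem kappaE_barrier (hcl : CondClosed 𝔖 P) (s : ℕ → ℕ) (hs : ∀ j, s (j + 1) = 2 * s j + 3 * 𝔖.r + 1)
    {A q ρ : ℝ} (hA : 0 < A) (hq : 0 < q) (hN : ∀ j, ((𝔖.a * 𝔖.growth (s j + 2 * 𝔖.r) : ℕ) : ℝ) ≤ A * q ^ j)
    (hseed : 𝔖.cst * A * q * kappaE 𝔖 P (s 0) ≤ ρ) :
    ∀ j, kappaE 𝔖 P (s j) ≤ ρ ^ 2 ^ j / (𝔖.cst * A * q ^ (j + 1)) := by
  have hc := 𝔖.cst_pos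
  set b : ℕ → ℝ := fun j => 𝔖.cst * A * q ^ (j + 1) * kappaE 𝔖 P (s j) with hb
  have hb0 : ∀ j, 0 ≤ b j := fun j => by
    have := kappaE_nonneg 𝔖 P (s j); simp only [hb]; positivity
  have hbstep : ∀ j, b (j + 1) ≤ b j ^ 2 := by
    intro j
    have hM : 2 * s j + 3 * 𝔖.r < s (j + 1) := by rw [hs j]; exact Nat.lt_succ_self _
    have h1 := ((kappaE_le_kappaD 𝔖 P (s (j + 1))).trans (kappaD_le_kappaP 𝔖 P (s (j + 1)))).trans
      (kappaP_stepE 𝔖 P hcl hM)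
    have hκ := kappaE_nonneg 𝔖 P (s j)
    have h2 : kappaE 𝔖 P (s (j + 1)) ≤ 𝔖.cst * (A * q ^ j) * kappaE 𝔖 P (s j) ^ 2 := by
      refine h1.trans ?_
      unfold Spec.cst
      have hlam := 𝔖.lam_pos
      have := hN j
      calc 𝔖.lam⁻¹ * ((𝔖.a * 𝔖.growth (s j + 2 * 𝔖.r) : ℕ) : ℝ) * (2 * 𝔖.R ^ 2) * kappaE 𝔖 P (s j) ^ 2
          ≤ 𝔖.lam⁻¹ * (A * q ^ j) * (2 * 𝔖.R ^ 2) * kappaE 𝔖 P (s j) ^ 2 := by gcongr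
        _ = 𝔖.lam⁻¹ * (2 * 𝔖.R ^ 2) * (A * q ^ j) * kappaE 𝔖 P (s j) ^ 2 := by ring
    simp only [hb]
    calc 𝔖.cst * A * q ^ (j + 1 + 1) * kappaE 𝔖 P (s (j + 1))
        ≤ 𝔖.cst * A * q ^ (j + 1 + 1) * (𝔖.cst * (A * q ^ j) * kappaE 𝔖 P (s j) ^ 2) := by
          have : 0 ≤ 𝔖.cst * A * q ^ (j + 1 + 1) := by positivity
          exact mul_le_mul_of_nonneg_left h2 this
      _ = (𝔖.cst * A * q ^ (j + 1) * kappaE 𝔖 P (s j)) ^ 2 := by ring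
  have hseed' : b 0 ≤ ρ := by simpa [hb] using hseed
  intro j
  have h := sq_barrier hb0 hbstep hseed' j
  simp only [hb] at h
  have hpos : 0 < 𝔖.cst * A * q ^ (j + 1) := by positivity
  rw [le_div_iff₀ hpos]
  calc kappaE 𝔖 P (s j) * (𝔖.cst * A * q ^ (j + 1)) = 𝔖.cst * A * q ^ (j + 1) * kappaE 𝔖 P (s j) := by ring
    _ ≤ ρ ^ 2 ^ j := h

/-- **THE FULL RELATIVE PROFILE FROM A PARENT-IN-CLASS GRADIENT-PARTNER SEED**: from the first doubled scale on,
`κ_P(s_{j+1}) ≤ ρ^{2^{j+1}} ∕ (c A q^{j+2})`. [cite: Martinelli1999, §2.4 p.103 (Def. 2.6, Thm 2.7); MartinelliOlivieri1994; HelfferSjostrand1994; Ledoux2001, Prop. 6.2 p.190] -/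
theorem kappaP_barrier_of_gradSeedE (hcl : CondClosed 𝔖 P) (s : ℕ → ℕ)
    (hs : ∀ j, s (j + 1) = 2 * s j + 3 * 𝔖.r + 1) {A q ρ : ℝ} (hA : 0 < A) (hq : 0 < q)
    (hN : ∀ j, ((𝔖.a * 𝔖.growth (s j + 2 * 𝔖.r) : ℕ) : ℝ) ≤ A * q ^ j)
    (hseed : 𝔖.cst * A * q * kappaE 𝔖 P (s 0) ≤ ρ) {j m : ℕ} (hm : s (j + 1) ≤ m) :
    kappaP 𝔖 P m ≤ ρ ^ 2 ^ (j + 1) / (𝔖.cst * A * q ^ (j + 2)) := by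
  refine (kappaP_antitone 𝔖 P hm).trans ?_
  have hc := 𝔖.cst_pos
  have hlam := 𝔖.lam_pos
  have hM : 2 * s j + 3 * 𝔖.r < s (j + 1) := by rw [hs j]; exact Nat.lt_succ_self _
  have hκ := kappaE_nonneg 𝔖 P (s j)
  have h1 := kappaP_stepE 𝔖 P hcl hM
  have h2 := kappaE_barrier 𝔖 P hcl s hs hA hq hN hseed j
  have hpos : 0 < 𝔖.cst * A * q ^ (j + 1) := by positivity
  have h3 : kappaE 𝔖 P (s j) ^ 2 ≤ (ρ ^ 2 ^ j / (𝔖.cst * A * q ^ (j + 1))) ^ 2 := pow_le_pow_left₀ hκ h2 2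
  have e : (ρ ^ 2 ^ j) ^ 2 = ρ ^ 2 ^ (j + 1) := by rw [← pow_mul, pow_succ]
  calc kappaP 𝔖 P (s (j + 1))
      ≤ 𝔖.lam⁻¹ * ((𝔖.a * 𝔖.growth (s j + 2 * 𝔖.r) : ℕ) : ℝ) * (2 * 𝔖.R ^ 2) * kappaE 𝔖 P (s j) ^ 2 := h1
    _ ≤ 𝔖.lam⁻¹ * (A * q ^ j) * (2 * 𝔖.R ^ 2) * (ρ ^ 2 ^ j / (𝔖.cst * A * q ^ (j + 1))) ^ 2 := by
        have := hN j
        gcongr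
    _ = ρ ^ 2 ^ (j + 1) / (𝔖.cst * A * q ^ (j + 2)) := by
        rw [← e]
        unfold Spec.cst
        field_simp
        ring

/-- **The parent-in-class gradient-partner seed, spelled out**: a POINTWISE bound `≤ ρ ∕ (c A q)` on the exact child
covariances of `P`-parents at separation `s₀` is the seed `c A q κ^E_P(s₀) ≤ ρ`.
[cite: Martinelli1999, §2.4 p.103 (Def. 2.6, Thm 2.7); GlimmJaffe1987, Cor. 4.3.4 (proof); BrascampLieb1976, Thm 4.1] -/
theorem kappaE_seed_of_forall {s₀ : ℕ} {A q ρ : ℝ} (hA : 0 < A) (hq : 0 < q) (hρ : 0 ≤ ρ)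
    (h : ∀ (lab : Fin n → Fin 3) (f f₁ f₂ : (Fin n → ℝ) → ℝ) (C : ℝ) (x : Fin n → ℝ) (j : Fin n)
      (F : (Fin n → ℝ) → ℝ) (B : Finset (Fin n)),
      𝔖.SideData lab f f₁ f₂ C → x ∈ cube n 𝔖.S → lab j = 1 → P f → P (condPot lab 𝔖.lam f₁ x) → 𝔖.Obs F B →
        (∀ i ∈ B, lab i = 0) → (∀ i ∈ B, s₀ + 𝔖.r < 𝔖.d i j) →
        |cubeCov (condPot lab 𝔖.lam f₁ x) 𝔖.S (fun z => F (merge lab x z))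
            (fun z => C⁻¹ * coordGradient f₁ (merge lab x z) j)| ≤ ρ / (𝔖.cst * A * q)) :
    𝔖.cst * A * q * kappaE 𝔖 P s₀ ≤ ρ := by
  have hc := 𝔖.cst_pos
  have hpos : 0 < 𝔖.cst * A * q := by positivity
  have hk : kappaE 𝔖 P s₀ ≤ ρ / (𝔖.cst * A * q) := kappaE_le_of_forall 𝔖 P (div_nonneg hρ hpos.le) h
  calc 𝔖.cst * A * q * kappaE 𝔖 P s₀ ≤ 𝔖.cst * A * q * (ρ / (𝔖.cst * A * q)) :=
        mul_le_mul_of_nonneg_left hk hpos.le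
    _ = ρ := mul_div_cancel₀ ρ hpos.ne'

/-- **In-situ read-out for ONE action in `𝔐_ε` from a parent-in-class gradient-partner seed over `𝔐_ε`.**
[cite: Martinelli1999, §2.4 p.103 (Def. 2.6, Thm 2.7); MartinelliOlivieri1994; BrascampLieb1976, Thm 4.1; Ledoux2001, Prop. 6.2 p.190; GlimmJaffe1987, Cor. 4.3.4 (proof)] -/
theorem abs_cubeCov_le_of_nearGauss_gradSeedE {ε : ℝ} {f₀ : (Fin n → ℝ) → ℝ} (h₀ : NearGauss 𝔖 ε f₀) (s : ℕ → ℕ)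
    (hs : ∀ j, s (j + 1) = 2 * s j + 3 * 𝔖.r + 1) {A q ρ : ℝ} (hA : 0 < A) (hq : 0 < q)
    (hN : ∀ j, ((𝔖.a * 𝔖.growth (s j + 2 * 𝔖.r) : ℕ) : ℝ) ≤ A * q ^ j)
    (hseed : 𝔖.cst * A * q * kappaE 𝔖 (NearGauss 𝔖 ε) (s 0) ≤ ρ) {j M : ℕ} (hM : s (j + 1) ≤ M)
    {F H : (Fin n → ℝ) → ℝ} (hAdm : 𝔖.Adm M f₀ F H) :
    |cubeCov f₀ 𝔖.S F H| ≤ ρ ^ 2 ^ (j + 1) / (𝔖.cst * A * q ^ (j + 2)) :=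
  (abs_cubeCov_le_kappaP 𝔖 (NearGauss 𝔖 ε) hAdm h₀).trans
    (kappaP_barrier_of_gradSeedE 𝔖 (NearGauss 𝔖 ε) (condClosed_nearGauss 𝔖 ε) s hs hA hq hN hseed hM)

end ProfileE


/-! ## §0 Helpers: linearity of the cube mean ∕ covariance, Brascamp–Lieb with a degenerate radius -/

section Helpers

/-- `⟨A − B⟩_K = ⟨A⟩_K − ⟨B⟩_K` (continuous inserts). [cite: Durrett2019, Thm 1.4.7 (ii)–(iii); GlimmJaffe1987, §4.3 (proof of Cor. 4.3.3)] -/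
theorem cubeMean_sub {f A B : (Fin n → ℝ) → ℝ} (hf : Continuous f) (hA : Continuous A) (hB : Continuous B)
    (S : ℝ) : cubeMean f S (fun x => A x - B x) = cubeMean f S A - cubeMean f S B := by
  unfold cubeMean
  have hE : Continuous fun x => Real.exp (-f x) := continuous_expNeg hf
  have iA : IntegrableOn (fun x => A x * Real.exp (-f x)) (cube n S) volume := integrableOn_cube' (hA.mul hE) S
  have iB : IntegrableOn (fun x => B x * Real.exp (-f x)) (cube n S) volume := integrableOn_cube' (hB.mul hE) S
  have e : (fun x => (A x - B x) * Real.exp (-f x)) = fun x => A x * Real.exp (-f x) - B x * Real.exp (-f x) := by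
    funext x; ring
  rw [e, integral_sub iA iB, sub_div]

/-- `Cov_K(F, A − B) = Cov_K(F, A) − Cov_K(F, B)` (continuous potential and inserts).
[cite: Durrett2019, Thm 1.4.7 (ii)–(iii); GlimmJaffe1987, §4.3 (proof of Cor. 4.3.3)] -/
theorem cubeCov_sub_right {S : ℝ} (hS : 0 < S) {f F A B : (Fin n → ℝ) → ℝ} (hf : Continuous f)
    (hF : Continuous F) (hA : Continuous A) (hB : Continuous B) :
    cubeCov f S F (fun x => A x - B x) = cubeCov f S F A - cubeCov f S F B := by
  rw [cubeCov_eq_sub hS hf hF (G := fun x => A x - B x) (hA.sub hB), cubeCov_eq_sub hS hf hF hA,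
    cubeCov_eq_sub hS hf hF hB, cubeMean_sub hf hA hB]
  have e : (fun x => F x * (A x - B x)) = fun x => F x * A x - F x * B x := by
    funext x; ring
  rw [e, cubeMean_sub hf (A := fun x => F x * A x) (B := fun x => F x * B x) (hF.mul hA) (hF.mul hB)]
  ring

/-- **(D1) with a degenerate second radius**: `f_xx ≥ λ`, `|∇F| ≤ a` (`a > 0`), `|∇G| ≤ b` with `b ≥ 0` ALLOWED ⇒
`|Cov_K(F,G)| ≤ λ⁻¹ab` (the tree's `abs_cubeCov_le` at radius `b + t`, `t ↓ 0`). [cite: BrascampLieb1976, Thm 4.1] -/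
theorem abs_cubeCov_le₀ {S lam : ℝ} (hS : 0 < S) (hlam : 0 < lam) {f F G : (Fin n → ℝ) → ℝ}
    (hf : ContDiff ℝ 2 f) (hB : HessianBound f lam) (hF : ContDiff ℝ 1 F) (hG : ContDiff ℝ 1 G)
    {a b : ℝ} (ha : 0 < a) (hb : 0 ≤ b)
    (hFa : ∀ x ∈ cube n S, coordGradient F x ⬝ᵥ coordGradient F x ≤ a ^ 2)
    (hGb : ∀ x ∈ cube n S, coordGradient G x ⬝ᵥ coordGradient G x ≤ b ^ 2) :
    |cubeCov f S F G| ≤ lam⁻¹ * a * b := by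
  refine le_of_forall_pos_le_add fun δ hδ => ?_
  set t : ℝ := lam * δ / a with ht
  have htpos : 0 < t := by positivity
  have hbt : ∀ x ∈ cube n S, coordGradient G x ⬝ᵥ coordGradient G x ≤ (b + t) ^ 2 := fun x hx =>
    (hGb x hx).trans (pow_le_pow_left₀ hb (le_add_of_nonneg_right htpos.le) 2)
  have h := abs_cubeCov_le hS hlam hf hB hF hG ha (by positivity) hFa hbt
  have ha' : a ≠ 0 := ha.ne'
  have hl' : lam ≠ 0 := hlam.ne'
  calc |cubeCov f S F G| ≤ lam⁻¹ * a * (b + t) := h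
    _ = lam⁻¹ * a * b + (lam⁻¹ * lam) * (a * a⁻¹) * δ := by
        rw [ht]
        ring
    _ = lam⁻¹ * a * b + δ := by
        rw [inv_mul_cancel₀ hl', mul_inv_cancel₀ ha']
        ring

/-- A vector whose entries are entries of `w` or `0` is not longer than `w` (re-proved; the tree's copies are private).
[folklore] [cite: HornJohnson2013, Thm 4.3.28 (4.3.30)] -/
private theorem dotProduct_self_le_of_eq_or_zero (v w : Fin n → ℝ) (h : ∀ i, v i = w i ∨ v i = 0) :
    v ⬝ᵥ v ≤ w ⬝ᵥ w :=
  Finset.sum_le_sum fun i _ => by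
    rcases h i with h | h
    · rw [h]
    · rw [h, mul_zero]; exact mul_self_nonneg _

end Helpers

/-! ## §2 Directional derivatives, the linear functional `z ↦ u·z`, and the Hessian as the gradient of `∂_w g` -/

section Directional

/-- The directional derivative `∂_w h := (z ↦ Dh(z) w) = Σ_k w_k ∂_k h` as a function. [cite: Spivak1965, Thm 2-7] -/
noncomputable def dD (h : (Fin n → ℝ) → ℝ) (w : Fin n → ℝ) : (Fin n → ℝ) → ℝ := fun z => fderiv ℝ h z w

/-- `∂_w h = Σ_k w_k ∂_k h`. [cite: Spivak1965, Thm 2-7] -/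
theorem dD_eq_sum (h : (Fin n → ℝ) → ℝ) (w z : Fin n → ℝ) : dD h w z = ∑ k, w k * coordGradient h z k :=
  fderiv_apply_eq_sum_coordGradient h z w

/-- `∂_{e_l} h = ∂_l h`. [cite: Spivak1965, Thm 2-7] -/
theorem dD_single (h : (Fin n → ℝ) → ℝ) (l : Fin n) : dD h (Pi.single l 1) = fun z => coordGradient h z l := rfl

/-- `g ∈ C² ⇒ ∂_w g ∈ C¹`. [cite: Spivak1965, Thm 2-7, Thm 2-8] -/
theorem contDiff_dD {g : (Fin n → ℝ) → ℝ} (hg : ContDiff ℝ 2 g) (w : Fin n → ℝ) : ContDiff ℝ 1 (dD g w) :=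
  (hg.fderiv_right (m := 1) (by norm_num)).clm_apply contDiff_const

/-- `h ∈ C¹ ⇒ ∂_w h` continuous. [cite: Spivak1965, Thm 2-8] -/
theorem continuous_dD {h : (Fin n → ℝ) → ℝ} (hh : ContDiff ℝ 1 h) (w : Fin n → ℝ) : Continuous (dD h w) :=
  (hh.continuous_fderiv one_ne_zero).clm_apply continuous_const

/-- `∂_w (Ψ − c) = ∂_w Ψ`. [cite: Spivak1965, Thm 2-3] -/
theorem dD_sub_const (Ψ : (Fin n → ℝ) → ℝ) (c : ℝ) (w : Fin n → ℝ) : dD (fun z => Ψ z - c) w = dD Ψ w := by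
  funext z
  simp only [dD]
  rw [fderiv_sub_const]

/-- The derivative of the linear functional `z ↦ u·z` is `Σ_i u_i proj_i`. [cite: Spivak1965, Thm 2-3] -/
theorem hasFDerivAt_dotProduct (u z : Fin n → ℝ) :
    HasFDerivAt (fun z : Fin n → ℝ => u ⬝ᵥ z)
      (∑ i, u i • (ContinuousLinearMap.proj i : (Fin n → ℝ) →L[ℝ] ℝ)) z :=
  HasFDerivAt.fun_sum fun i _ =>
    ((ContinuousLinearMap.proj i : (Fin n → ℝ) →L[ℝ] ℝ).hasFDerivAt).const_smul (u i)

/-- `z ↦ u·z` is `C¹`. [cite: Spivak1965, Thm 2-3] -/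
theorem contDiff_dotProduct (u : Fin n → ℝ) : ContDiff ℝ 1 (fun z : Fin n → ℝ => u ⬝ᵥ z) :=
  ContDiff.sum fun i _ => contDiff_const.mul ((ContinuousLinearMap.proj i : (Fin n → ℝ) →L[ℝ] ℝ).contDiff)

/-- `∇(z ↦ u·z) = u`. [cite: Spivak1965, Thm 2-3] -/
theorem coordGradient_dotProduct (u z : Fin n → ℝ) : coordGradient (fun z : Fin n → ℝ => u ⬝ᵥ z) z = u := by
  funext i
  simp only [coordGradient]
  rw [(hasFDerivAt_dotProduct u z).fderiv]
  simp only [FunLike.coe_sum, FunLike.coe_smul, Finset.sum_apply, Pi.smul_apply,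
    ContinuousLinearMap.proj_apply, smul_eq_mul]
  rw [Finset.sum_eq_single i (fun k _ hk => by rw [Pi.single_eq_of_ne hk, mul_zero])
    (fun h => absurd (Finset.mem_univ i) h), Pi.single_eq_same, mul_one]

/-- **The gradient of `∂_w g` is the Hessian applied to `w`**: `∇(∂_w g)(z) = g_xx(z) w` for `g ∈ C²` (no symmetry
used: `(g_xx w)_i = Σ_k w_k ∂_i∂_k g`). [cite: Spivak1965, Thm 2-3, Thm 2-7] -/
theorem coordGradient_dD {g : (Fin n → ℝ) → ℝ} (hg : ContDiff ℝ 2 g) (w z : Fin n → ℝ) :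
    coordGradient (dD g w) z = coordHessian g z *ᵥ w := by
  have hdk : ∀ k, Differentiable ℝ (fun y => coordGradient g y k) := fun k =>
    (contDiff_one_coordGradient hg k).differentiable one_ne_zero
  have e : dD g w = fun z => ∑ k, w k * coordGradient g z k := funext fun z => dD_eq_sum g w z
  funext i
  rw [e]
  show fderiv ℝ (fun z => ∑ k, w k * coordGradient g z k) z (Pi.single i 1) = ∑ k, coordHessian g z i k * w k
  rw [fderiv_fun_sum fun k _ => (hdk k z).const_mul (w k)]
  simp only [FunLike.coe_sum, Finset.sum_apply]
  refine Finset.sum_congr rfl fun k _ => ?_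
  rw [fderiv_const_mul (hdk k z) (w k), FunLike.coe_smul, Pi.smul_apply, smul_eq_mul, mul_comm]
  rfl

end Directional

/-! ## §3 THE WALL FUNCTIONAL (Stein defect of the hard window) and `Cov_K(Ψ, ∂_w g) = ⟨∂_w Ψ⟩_K − Wall_w(Ψ − ⟨Ψ⟩_K)` -/

section Wall

/-- **THE WALL FUNCTIONAL** of the window `K = [-S,S]ⁿ` for the potential `g` in direction `w`:
`Wall_w(Ψ) := ⟨∂_w Ψ⟩_K − ⟨Ψ ∂_w g⟩_K` — the defect in the Stein ∕ integration-by-parts identity caused by the HARD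
wall; on `[-S,S]^{m+1}` and `w = e_l` it is the normalised flux `(∫_{face l=+S} Ψe^{-g} − ∫_{face l=−S} Ψe^{-g}) ∕ Z_K`
(`wallDefect_single_mul_cubeMass`, from the tree's `stein_faces`).  It VANISHES for every `Ψ` iff the window is
invisible to `∂_w` (no wall, or `e^{-g}` negligible on the two faces). [cite: GlimmJaffe1987, §9.1 (9.1.32); Spivak1965, Thm 4-13] -/
noncomputable def wallDefect (g : (Fin n → ℝ) → ℝ) (S : ℝ) (w : Fin n → ℝ) (Ψ : (Fin n → ℝ) → ℝ) : ℝ :=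
  cubeMean g S (dD Ψ w) - cubeMean g S (fun z => Ψ z * dD g w z)

/-- **`Cov_K(Ψ, ∂_w g) = ⟨∂_w Ψ⟩_K − Wall_w(Ψ − ⟨Ψ⟩_K)`** (centred = uncentred covariance and linearity of the mean;
an identity of the window model, no convexity). With NO wall this is the exact Gaussian-type integration by parts
`Cov(Ψ, ∂_w g) = ⟨∂_w Ψ⟩`. [cite: GlimmJaffe1987, §9.1 (9.1.32), §4.3 (proof of Cor. 4.3.3)] -/
theorem cubeCov_dD_eq {S : ℝ} (hS : 0 < S) {g Ψ : (Fin n → ℝ) → ℝ} (hg : ContDiff ℝ 2 g) (hΨ : ContDiff ℝ 1 Ψ)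
    (w : Fin n → ℝ) :
    cubeCov g S Ψ (dD g w) = cubeMean g S (dD Ψ w) - wallDefect g S w (fun z => Ψ z - cubeMean g S Ψ) := by
  have hgc : Continuous g := hg.continuous
  have hΨc : Continuous Ψ := hΨ.continuous
  have hDc : Continuous (dD g w) := continuous_dD (hg.of_le (by norm_num)) w
  unfold wallDefect
  have e2 : (fun z => (Ψ z - cubeMean g S Ψ) * dD g w z)
      = fun z => Ψ z * dD g w z - cubeMean g S Ψ * dD g w z := by
    funext z; ring
  rw [dD_sub_const, e2, cubeMean_sub hgc (A := fun z => Ψ z * dD g w z) (B := fun z => cubeMean g S Ψ * dD g w z)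
    (hΨc.mul hDc) (continuous_const.mul hDc), cubeMean_const_mul, cubeCov_eq_sub hS hgc hΨc hDc]
  ring

/-- **The wall functional IS the face flux** on `[-S,S]^{m+1}`: `Wall_{e_l}(Ψ) · Z_K = ∫_{face l=+S} Ψ e^{-g} −
∫_{face l=−S} Ψ e^{-g}` (the tree's Stein identity with faces `stein_faces`). [cite: GlimmJaffe1987, §9.1 (9.1.32); Spivak1965, Thm 4-13] -/
theorem wallDefect_single_mul_cubeMass {m : ℕ} {S : ℝ} (hS : 0 < S) {g Ψ : (Fin (m + 1) → ℝ) → ℝ}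
    (hg : ContDiff ℝ 1 g) (hΨ : ContDiff ℝ 1 Ψ) (l : Fin (m + 1)) :
    wallDefect g S (Pi.single l 1) Ψ * cubeMass g S =
      (∫ y in cube m S, Ψ (Fin.insertNth l S y) * Real.exp (-g (Fin.insertNth l S y)))
        - ∫ y in cube m S, Ψ (Fin.insertNth l (-S) y) * Real.exp (-g (Fin.insertNth l (-S) y)) := by
  have hZ : cubeMass g S ≠ 0 := (cubeMass_pos hg.continuous hS).ne'
  have st := stein_faces hS hg hΨ l
  unfold wallDefect cubeMean
  rw [dD_single, dD_single, sub_mul, div_mul_cancel₀ _ hZ, div_mul_cancel₀ _ hZ, st]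
  ring

end Wall

/-! ## §4 THE STEIN REDUCTION of a covariance against a NEAR-AFFINE partner -/

section Reduction

/-- **THE STEIN REDUCTION (PROVED).**  On the window `K = [-S,S]ⁿ` with `g_xx ≥ λ`, for inserts `Φ ∈ C¹` (`|∇Φ| ≤ 1`
on `K`) and `G ∈ C¹`, ANY base point `z₀` and ANY direction `w` solving `g_xx(z₀) w = ∇G(z₀)`:
`|Cov_K(Φ, G)| ≤ |⟨∂_w Φ⟩_K| + |Wall_w(Φ − ⟨Φ⟩_K)| + λ⁻¹ (δ_G + δ_H)`, where `δ_G` bounds the oscillation `|∇G(z) −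
∇G(z₀)|` of the partner's gradient over `K` and `δ_H` the Hessian oscillation `|(g_xx(z) − g_xx(z₀)) w|` over `K`.
Proof: `G = (G − u·z) + (u·z − ∂_w g) + ∂_w g` with `u = ∇G(z₀) = g_xx(z₀) w`; Brascamp–Lieb on the two differences
(gradients `∇G − u` and `(g_xx(z₀) − g_xx(z)) w`), `cubeCov_dD_eq` on the last.  For a Gaussian `g` and an affine `G`
(`δ_G = δ_H = 0`) it reads `|Cov_K(Φ,G)| ≤ |⟨∂_w Φ⟩_K| + |Wall_w(Φ̃)|` — exact up to the wall.
[cite: BrascampLieb1976, Thm 4.1; GlimmJaffe1987, §9.1 (9.1.32), §4.3 (proof of Cor. 4.3.3); HelfferSjostrand1994] -/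
theorem abs_cubeCov_le_stein {S lam : ℝ} (hS : 0 < S) (hlam : 0 < lam) {g Φ G : (Fin n → ℝ) → ℝ}
    (hg : ContDiff ℝ 2 g) (hB : HessianBound g lam) (hΦ : ContDiff ℝ 1 Φ)
    (hΦ1 : ∀ z ∈ cube n S, coordGradient Φ z ⬝ᵥ coordGradient Φ z ≤ 1) (hG : ContDiff ℝ 1 G)
    (w z₀ : Fin n → ℝ) (hw : coordHessian g z₀ *ᵥ w = coordGradient G z₀) {δG δH : ℝ} (hδG : 0 ≤ δG)
    (hδH : 0 ≤ δH)
    (hGosc : ∀ z ∈ cube n S, (coordGradient G z - coordGradient G z₀) ⬝ᵥ (coordGradient G z - coordGradient G z₀)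
      ≤ δG ^ 2)
    (hHosc : ∀ z ∈ cube n S, ((coordHessian g z - coordHessian g z₀) *ᵥ w)
      ⬝ᵥ ((coordHessian g z - coordHessian g z₀) *ᵥ w) ≤ δH ^ 2) :
    |cubeCov g S Φ G| ≤ |cubeMean g S (dD Φ w)| + |wallDefect g S w (fun z => Φ z - cubeMean g S Φ)|
      + lam⁻¹ * (δG + δH) := by
  set u : Fin n → ℝ := coordGradient G z₀ with hu
  have hℓ1 : ContDiff ℝ 1 (fun z : Fin n → ℝ => u ⬝ᵥ z) := contDiff_dotProduct u
  have hD1 : ContDiff ℝ 1 (dD g w) := contDiff_dD hg w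
  have hgc : Continuous g := hg.continuous
  have hΦc : Continuous Φ := hΦ.continuous
  have hGd : Differentiable ℝ G := hG.differentiable one_ne_zero
  have hℓd : Differentiable ℝ (fun z : Fin n → ℝ => u ⬝ᵥ z) := hℓ1.differentiable one_ne_zero
  have hDd : Differentiable ℝ (dD g w) := hD1.differentiable one_ne_zero
  have hΦ1' : ∀ z ∈ cube n S, coordGradient Φ z ⬝ᵥ coordGradient Φ z ≤ (1 : ℝ) ^ 2 := fun z hz => by
    rw [one_pow]; exact hΦ1 z hz
  -- the decomposition `G = (G − u·z) + (u·z − ∂_w g) + ∂_w g` inside the covariance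
  have e : cubeCov g S Φ G = cubeCov g S Φ (fun z => G z - u ⬝ᵥ z)
      + cubeCov g S Φ (fun z => u ⬝ᵥ z - dD g w z) + cubeCov g S Φ (dD g w) := by
    rw [cubeCov_sub_right hS hgc hΦc hG.continuous hℓ1.continuous,
      cubeCov_sub_right hS hgc hΦc hℓ1.continuous hD1.continuous]
    ring
  -- Brascamp–Lieb on the two differences
  have h1 : |cubeCov g S Φ (fun z => G z - u ⬝ᵥ z)| ≤ lam⁻¹ * 1 * δG := by
    refine abs_cubeCov_le₀ hS hlam hg hB hΦ (hG.sub hℓ1) one_pos hδG hΦ1' fun z hz => ?_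
    rw [coordGradient_sub hGd hℓd, coordGradient_dotProduct]
    exact hGosc z hz
  have h2 : |cubeCov g S Φ (fun z => u ⬝ᵥ z - dD g w z)| ≤ lam⁻¹ * 1 * δH := by
    refine abs_cubeCov_le₀ hS hlam hg hB hΦ (hℓ1.sub hD1) one_pos hδH hΦ1' fun z hz => ?_
    rw [coordGradient_sub hℓd hDd, coordGradient_dotProduct, coordGradient_dD hg, ← hw]
    have ev : coordHessian g z₀ *ᵥ w - coordHessian g z *ᵥ w = -((coordHessian g z - coordHessian g z₀) *ᵥ w) := by
      rw [sub_mulVec]; abel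
    rw [ev, neg_dotProduct, dotProduct_neg, neg_neg]
    exact hHosc z hz
  -- the Stein identity on the last piece, and the triangle inequality
  rw [e, cubeCov_dD_eq hS hg hΦ w]
  have h3 := abs_sub (cubeMean g S (dD Φ w)) (wallDefect g S w (fun z => Φ z - cubeMean g S Φ))
  have h4 := abs_add_le (cubeCov g S Φ (fun z => G z - u ⬝ᵥ z) + cubeCov g S Φ (fun z => u ⬝ᵥ z - dD g w z))
    (cubeMean g S (dD Φ w) - wallDefect g S w (fun z => Φ z - cubeMean g S Φ))
  have h5 := abs_add_le (cubeCov g S Φ (fun z => G z - u ⬝ᵥ z)) (cubeCov g S Φ (fun z => u ⬝ᵥ z - dD g w z))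
  rw [mul_one] at h1 h2
  rw [mul_add]
  linarith [h1, h2, h3, h4, h5]

/-- **A solving direction always exists**: `g_xx(z₀) ≥ λ > 0` is invertible, so `w := g_xx(z₀)⁻¹ ∇G(z₀)` solves
`g_xx(z₀) w = ∇G(z₀)`. [cite: HornJohnson2013, Thm 4.3.28 (4.3.30); BrascampLieb1976, Thm 4.1] -/
theorem exists_dir {lam : ℝ} (hlam : 0 < lam) {g : (Fin n → ℝ) → ℝ} (hg : ContDiff ℝ 2 g) (hB : HessianBound g lam)
    (z₀ v : Fin n → ℝ) : ∃ w : Fin n → ℝ, coordHessian g z₀ *ᵥ w = v := by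
  have hpd : (coordHessian g z₀).PosDef := posDef_of_hessianBound hg hlam hB z₀
  have hdet : IsUnit (coordHessian g z₀).det := (Matrix.isUnit_iff_isUnit_det _).mp hpd.isUnit
  exact ⟨(coordHessian g z₀)⁻¹ *ᵥ v, by rw [mulVec_mulVec, mul_nonsing_inv _ hdet, one_mulVec]⟩

end Reduction

/-! ## §5 The gradient partner is NEAR-AFFINE (parent in `𝔐_ε`), and THE SEED FROM THREE UNIFORM INPUTS -/

section Partner

variable (𝔖 : Spec n) (P : ((Fin n → ℝ) → ℝ) → Prop)

/-- `∇∂_j f (y)_i = (f_xx(y))_{ij}` (definitional). [cite: Spivak1965, Thm 2-7] -/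
theorem coordGradient_coordGradient_eq (f : (Fin n → ℝ) → ℝ) (y : Fin n → ℝ) (i j : Fin n) :
    coordGradient (fun y => coordGradient f y j) y i = coordHessian f y i j := by
  simp only [coordHessian, coordGradient, Matrix.of_apply]

/-- Symmetry of second partials for `f ∈ C²`: `∂_i∂_j f = ∂_j∂_i f`. [cite: Spivak1965, Thm 2-5] -/
theorem coordGradient_coordGradient_comm {f : (Fin n → ℝ) → ℝ} (hf : ContDiff ℝ 2 f) (y : Fin n → ℝ)
    (i j : Fin n) :
    coordGradient (fun y => coordGradient f y j) y i = coordGradient (fun y => coordGradient f y i) y j := by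
  rw [coordGradient_coordGradient_eq, coordGradient_coordGradient_eq, ← transpose_apply (coordHessian f y) j i,
    BrascampLiebCalculus.coordHessian_transpose hf]

/-- Every label is `0`, `1` or `2`. [folklore] -/
private theorem fin3_cases (t : Fin 3) : t = 0 ∨ t = 1 ∨ t = 2 := by
  revert t; decide

/-- **THE GRADIENT OF THE GRADIENT PARTNER is the inside-masked Hessian ROW `j` OF THE PARENT** (along one-sided data,
shell coordinate `j`): `∇(C⁻¹ ∂_j f₁ ∘ merge_x)(z)_i = C⁻¹ · 1[lab i = 0] · (f_xx(merge_x z))_{ij}` — the chain rule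
through `merge` (module IV), `∂_i∂_j f₁ = ∂_j∂_i f₁ = ∂_j∂_i f` on inside rows (the `inside` field, symmetry twice),
and `∂_i∂_j f₁ = 0` on outside rows (`f₁` is outside-blind).  The child's own Hessian never sees this column: the
shell direction `j` is frozen in `condPot`. [cite: Spivak1965, Thm 2-2 (chain rule), Thm 2-5; FriedliVelenik2017, Lemma 6.7 (6.7); FriedliVelenik2017, §6.10.1 (6.110)] -/
theorem coordGradient_partner {lab : Fin n → Fin 3} {f f₁ f₂ : (Fin n → ℝ) → ℝ} {C : ℝ}
    (hD : 𝔖.SideData lab f f₁ f₂ C) (x : Fin n → ℝ) (j : Fin n) (z : Fin n → ℝ) (i : Fin n) :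
    coordGradient (fun z => C⁻¹ * coordGradient f₁ (merge lab x z) j) z i
      = C⁻¹ * (if lab i = 0 then coordGradient (fun y => coordGradient f y j) (merge lab x z) i else 0) := by
  obtain ⟨hfc, -, -, -⟩ := hD.inClass
  have h1 : ContDiff ℝ 1 (fun y => coordGradient f₁ y j) := contDiff_one_coordGradient hD.cd₁ j
  have hd : Differentiable ℝ (fun y => coordGradient f₁ y j) := h1.differentiable one_ne_zero
  have hdm : Differentiable ℝ (fun z => coordGradient f₁ (merge lab x z) j) :=
    hd.comp ((contDiff_merge_right lab x (m := 1)).differentiable one_ne_zero)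
  rw [coordGradient_const_mul hdm C⁻¹ z, Pi.smul_apply, smul_eq_mul, coordGradient_comp_merge_right lab hd x z i]
  congr 1
  rcases fin3_cases (lab i) with h0 | h1' | h2
  · rw [if_pos (by rw [h0]; decide), if_pos h0]
    have e₁ : (fun y => coordGradient f₁ y i) = fun y => coordGradient f y i := funext (hD.inside i h0)
    rw [coordGradient_coordGradient_comm hD.cd₁, e₁, coordGradient_coordGradient_comm hfc]
  · rw [if_neg (by rw [h1']; decide), if_neg (by rw [h1']; decide)]
  · rw [if_pos (by rw [h2]; decide), if_neg (by rw [h2]; decide)]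
    exact coordGradient_eq_zero_of_dependsOn (dependsOn_coordGradient hD.dep₁ (hD.cd₁.of_le (by norm_num)) j)
      (s := {i | lab i ≠ 2}) (by simp [h2]) _

/-- **THE GRADIENT PARTNER IS NEAR-AFFINE for a parent in `𝔐_ε`**: its gradient oscillates by at most `C⁻¹ε` in `ℓ²`
over the whole space (`RowOsc ε f` on row `j`, masking does not increase `ℓ²` differences).  For `ε = 0` (Gaussian
parent) the partner is AFFINE. [cite: BrascampLieb1976, Thm 4.1; Ledoux2001, Prop. 6.2 p.190; HornJohnson2013, Thm 4.3.28 (4.3.30)] -/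
theorem partner_grad_osc {lab : Fin n → Fin 3} {f f₁ f₂ : (Fin n → ℝ) → ℝ} {C : ℝ} (hD : 𝔖.SideData lab f f₁ f₂ C)
    {ε : ℝ} (hε : RowOsc ε f) (x : Fin n → ℝ) (j : Fin n) (z z' : Fin n → ℝ) :
    (coordGradient (fun z => C⁻¹ * coordGradient f₁ (merge lab x z) j) z
        - coordGradient (fun z => C⁻¹ * coordGradient f₁ (merge lab x z) j) z')
      ⬝ᵥ (coordGradient (fun z => C⁻¹ * coordGradient f₁ (merge lab x z) j) z
        - coordGradient (fun z => C⁻¹ * coordGradient f₁ (merge lab x z) j) z') ≤ (C⁻¹ * ε) ^ 2 := by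
  set row : (Fin n → ℝ) → Fin n → ℝ := fun y => coordGradient (fun y => coordGradient f y j) y with hrow
  have e : ∀ z, coordGradient (fun z => C⁻¹ * coordGradient f₁ (merge lab x z) j) z
      = fun i => C⁻¹ * (if lab i = 0 then row (merge lab x z) i else 0) :=
    fun z => funext fun i => coordGradient_partner 𝔖 hD x j z i
  set m : Fin n → ℝ := fun i => if lab i = 0 then (row (merge lab x z) - row (merge lab x z')) i else 0 with hm
  have hsub : (fun i => C⁻¹ * (if lab i = 0 then row (merge lab x z) i else 0))
      - (fun i => C⁻¹ * (if lab i = 0 then row (merge lab x z') i else 0)) = C⁻¹ • m := by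
    funext i
    simp only [hm, Pi.sub_apply, Pi.smul_apply, smul_eq_mul]
    split_ifs <;> ring
  rw [e z, e z', hsub, smul_dotProduct, dotProduct_smul, smul_eq_mul, smul_eq_mul]
  have hmm : m ⬝ᵥ m ≤ (row (merge lab x z) - row (merge lab x z')) ⬝ᵥ (row (merge lab x z) - row (merge lab x z')) :=
    dotProduct_self_le_of_eq_or_zero m _ fun i => by
      simp only [hm]
      split_ifs
      · exact Or.inl rfl
      · exact Or.inr rfl
  have hr := hε j (merge lab x z) (merge lab x z')
  have hC : 0 ≤ C⁻¹ := inv_nonneg.mpr hD.C_pos.le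
  calc C⁻¹ * (C⁻¹ * (m ⬝ᵥ m)) ≤ C⁻¹ * (C⁻¹ * ε ^ 2) := by gcongr; exact hmm.trans hr
    _ = (C⁻¹ * ε) ^ 2 := by ring

/-- **THE PARENT-IN-CLASS GRADIENT-PARTNER SEED FROM THREE UNIFORM INPUTS (PROVED REDUCTION).**  Let `P ⊆ {RowOsc ε}`
(e.g. `P = 𝔐_ε`).  If for every exact child triple of a `P`-parent at separation `s₀` there are a base point `z₀`, a
direction `w` solving `g_xx(z₀) w = ∇G(z₀)` (`g` the child, `G = C⁻¹∂_j f₁ ∘ merge_x` the partner; `exists_dir`) and a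
Hessian-oscillation radius `δ_H` along `w`, such that
(W1) MAIN TERM + (W2) WALL TERM + (W3) PERTURBATIVE TERM: `|⟨∂_w Φ⟩_K| + |Wall_w(Φ − ⟨Φ⟩_K)| + λ⁻¹(C⁻¹ε + δ_H) ≤ ρ ∕ (c A q)`,
then the seed `c A q κ^E_P(s₀) ≤ ρ` holds — and with it the whole doubly-exponential profile (`kappaE_barrier`,
`kappaP_barrier_of_gradSeedE`, `abs_cubeCov_le_of_nearGauss_gradSeedE`).  (W1) is where the finite range and the
separation `d(B, j) > s₀ + r` enter (Combes–Thomas decay of `w = g_xx(z₀)⁻¹ ∇G(z₀)` away from `B_r(j)`, `∂_w Φ =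
Σ_{k ∈ B} w_k ∂_k Φ`); (W3) is perturbative; (W2) — the face flux of the HARD window — is the located obstruction: it is
NOT small uniformly in the boundary condition `x` (corner data push the conditional mode to a face), see the header.
[cite: BrascampLieb1976, Thm 4.1; GlimmJaffe1987, §9.1 (9.1.32), Cor. 4.3.4 (proof); Martinelli1999, §2.4 p.103 (Def. 2.6, Thm 2.7); HelfferSjostrand1994; CombesThomas1973, §II] -/
theorem kappaE_seed_of_stein {ε : ℝ} (hε : 0 ≤ ε) (hPε : ∀ f, P f → RowOsc ε f) {s₀ : ℕ} {A q ρ : ℝ}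
    (hA : 0 < A) (hq : 0 < q) (hρ : 0 ≤ ρ)
    (h : ∀ (lab : Fin n → Fin 3) (f f₁ f₂ : (Fin n → ℝ) → ℝ) (C : ℝ) (x : Fin n → ℝ) (j : Fin n)
      (F : (Fin n → ℝ) → ℝ) (B : Finset (Fin n)),
      𝔖.SideData lab f f₁ f₂ C → x ∈ cube n 𝔖.S → lab j = 1 → P f → P (condPot lab 𝔖.lam f₁ x) → 𝔖.Obs F B →
        (∀ i ∈ B, lab i = 0) → (∀ i ∈ B, s₀ + 𝔖.r < 𝔖.d i j) →
        ∃ (w z₀ : Fin n → ℝ) (δH : ℝ), 0 ≤ δH ∧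
          coordHessian (condPot lab 𝔖.lam f₁ x) z₀ *ᵥ w
            = coordGradient (fun z => C⁻¹ * coordGradient f₁ (merge lab x z) j) z₀ ∧
          (∀ z ∈ cube n 𝔖.S,
            ((coordHessian (condPot lab 𝔖.lam f₁ x) z - coordHessian (condPot lab 𝔖.lam f₁ x) z₀) *ᵥ w)
              ⬝ᵥ ((coordHessian (condPot lab 𝔖.lam f₁ x) z - coordHessian (condPot lab 𝔖.lam f₁ x) z₀) *ᵥ w)
              ≤ δH ^ 2) ∧
          |cubeMean (condPot lab 𝔖.lam f₁ x) 𝔖.S (dD (fun z => F (merge lab x z)) w)|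
            + |wallDefect (condPot lab 𝔖.lam f₁ x) 𝔖.S w (fun z => F (merge lab x z)
                - cubeMean (condPot lab 𝔖.lam f₁ x) 𝔖.S (fun z => F (merge lab x z)))|
            + 𝔖.lam⁻¹ * (C⁻¹ * ε + δH) ≤ ρ / (𝔖.cst * A * q)) :
    𝔖.cst * A * q * kappaE 𝔖 P s₀ ≤ ρ := by
  refine kappaE_seed_of_forall 𝔖 P hA hq hρ fun lab f f₁ f₂ C x j F B hD hx hj hPf hPc hF hB0 hB1 => ?_
  obtain ⟨w, z₀, δH, hδH, hw, hHosc, hsum⟩ := h lab f f₁ f₂ C x j F B hD hx hj hPf hPc hF hB0 hB1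
  obtain ⟨hgc2, hgB, -, -⟩ := 𝔖.inClass_condPot hD x
  obtain ⟨hFc, hFg, -, -⟩ := hF
  have hΦ : ContDiff ℝ 1 (fun z => F (merge lab x z)) := hFc.comp (contDiff_merge_right lab x)
  have hΦ1 : ∀ z ∈ cube n 𝔖.S, coordGradient (fun z => F (merge lab x z)) z
      ⬝ᵥ coordGradient (fun z => F (merge lab x z)) z ≤ 1 := fun z _ =>
    (gradSq_comp_merge_le lab (hFc.differentiable one_ne_zero) x z).trans (hFg _)
  have hG : ContDiff ℝ 1 (fun z => C⁻¹ * coordGradient f₁ (merge lab x z) j) :=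
    contDiff_const.mul ((contDiff_one_coordGradient hD.cd₁ j).comp (contDiff_merge_right lab x))
  have hδG : 0 ≤ C⁻¹ * ε := mul_nonneg (inv_nonneg.mpr hD.C_pos.le) hε
  have key := abs_cubeCov_le_stein 𝔖.S_pos 𝔖.lam_pos hgc2 hgB hΦ hΦ1 hG w z₀ hw hδG hδH
    (fun z _ => partner_grad_osc 𝔖 hD (hPε f hPf) x j z z₀) hHosc
  exact key.trans hsum

end Partner

/-! ## §6 Discharging (W3) from the child's row oscillation and (W1) down to the `ℓ¹`-mass of `w` on the support -/

section Discharge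

variable (𝔖 : Spec n) (P : ((Fin n → ℝ) → ℝ) → Prop)

/-- Two vectors of `ℓ²`-length `≤ ε` have `|a·b| ≤ ε²` (no square roots: `(a ± b)·(a ± b) ≥ 0`). [cite: HornJohnson2013, Thm 5.1.4 (Cauchy–Schwarz)] -/
theorem abs_dotProduct_le_sq {a b : Fin n → ℝ} {ε : ℝ} (ha : a ⬝ᵥ a ≤ ε ^ 2) (hb : b ⬝ᵥ b ≤ ε ^ 2) :
    |a ⬝ᵥ b| ≤ ε ^ 2 := by
  have h1 : 0 ≤ (a - b) ⬝ᵥ (a - b) := Finset.sum_nonneg fun i _ => mul_self_nonneg _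
  have h2 : 0 ≤ (a + b) ⬝ᵥ (a + b) := Finset.sum_nonneg fun i _ => mul_self_nonneg _
  rw [sub_dotProduct, dotProduct_sub, dotProduct_sub] at h1
  rw [add_dotProduct, dotProduct_add, dotProduct_add] at h2
  rw [dotProduct_comm b a] at h1 h2
  rw [abs_le]
  constructor <;> linarith

/-- **`ℓ¹–ℓ²` bound**: a linear combination `Σ_k c_k d_k` of vectors of length `≤ ε` has length `≤ (Σ_k |c_k|) ε`.
[cite: HornJohnson2013, Thm 5.1.4 (Cauchy–Schwarz)] -/
theorem dotProduct_self_sum_smul_le {ι : Type*} (s : Finset ι) (c : ι → ℝ) (d : ι → Fin n → ℝ) {ε : ℝ}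
    (hd : ∀ k ∈ s, d k ⬝ᵥ d k ≤ ε ^ 2) :
    (∑ k ∈ s, c k • d k) ⬝ᵥ (∑ k ∈ s, c k • d k) ≤ (∑ k ∈ s, |c k|) ^ 2 * ε ^ 2 := by
  rw [sum_dotProduct]
  simp_rw [dotProduct_sum, smul_dotProduct, dotProduct_smul, smul_eq_mul]
  calc ∑ k ∈ s, ∑ l ∈ s, c k * (c l * (d k ⬝ᵥ d l)) ≤ ∑ k ∈ s, ∑ l ∈ s, |c k| * (|c l| * ε ^ 2) := by
        refine Finset.sum_le_sum fun k hk => Finset.sum_le_sum fun l hl => ?_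
        have h := abs_dotProduct_le_sq (hd k hk) (hd l hl)
        calc c k * (c l * (d k ⬝ᵥ d l)) ≤ |c k * (c l * (d k ⬝ᵥ d l))| := le_abs_self _
          _ = |c k| * (|c l| * |d k ⬝ᵥ d l|) := by rw [abs_mul, abs_mul]
          _ ≤ |c k| * (|c l| * ε ^ 2) := by gcongr
    _ = (∑ k ∈ s, |c k|) ^ 2 * ε ^ 2 := by
        rw [sq (∑ k ∈ s, |c k|), Finset.sum_mul_sum, Finset.sum_mul]
        refine Finset.sum_congr rfl fun k _ => ?_
        rw [Finset.sum_mul]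
        refine Finset.sum_congr rfl fun l _ => ?_
        ring

/-- **(W3) from the CHILD's row oscillation**: `RowOsc ε g ⇒ |(g_xx(z) − g_xx(z')) w|₂ ≤ ‖w‖₁ ε` — the Hessian-
oscillation radius along `w` is `δ_H = (Σ_k |w_k|) ε` (crude `ℓ¹` form; an operator-norm small-field class would give
`‖w‖₂ ε`). [cite: HornJohnson2013, Thm 5.1.4 (Cauchy–Schwarz); BrascampLieb1976, Thm 4.1; Ledoux2001, Prop. 6.2 p.190] -/
theorem hessian_mulVec_osc {ε : ℝ} {g : (Fin n → ℝ) → ℝ} (hR : RowOsc ε g) (w z z' : Fin n → ℝ) :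
    ((coordHessian g z - coordHessian g z') *ᵥ w) ⬝ᵥ ((coordHessian g z - coordHessian g z') *ᵥ w)
      ≤ ((∑ k, |w k|) * ε) ^ 2 := by
  set d : Fin n → Fin n → ℝ := fun k =>
    coordGradient (fun y => coordGradient g y k) z - coordGradient (fun y => coordGradient g y k) z' with hd_def
  have e : (coordHessian g z - coordHessian g z') *ᵥ w = ∑ k, w k • d k := by
    funext i
    rw [Finset.sum_apply]
    simp only [mulVec, dotProduct, Pi.smul_apply, smul_eq_mul, hd_def, Pi.sub_apply, Matrix.sub_apply,
      coordGradient_coordGradient_eq]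
    exact Finset.sum_congr rfl fun k _ => by ring
  rw [e, mul_pow]
  exact dotProduct_self_sum_smul_le Finset.univ w d fun k _ => hR k z z'

/-- `|h| ≤ M` everywhere ⇒ `|⟨h⟩_K| ≤ M`. [cite: Durrett2019, Thm 1.4.7 (iv), (vi)] -/
theorem abs_cubeMean_le {S : ℝ} (hS : 0 < S) {f h : (Fin n → ℝ) → ℝ} (hf : Continuous f) (hh : Continuous h)
    {M : ℝ} (hM : ∀ x, |h x| ≤ M) : |cubeMean f S h| ≤ M := by
  have hZ := cubeMass_pos hf hS
  have hE : Continuous fun x => Real.exp (-f x) := continuous_expNeg hf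
  have ih : IntegrableOn (fun x => h x * Real.exp (-f x)) (cube n S) volume := integrableOn_cube' (hh.mul hE) S
  have iM : IntegrableOn (fun x => M * Real.exp (-f x)) (cube n S) volume :=
    integrableOn_cube' (continuous_const.mul hE) S
  have iM' : IntegrableOn (fun x => -M * Real.exp (-f x)) (cube n S) volume :=
    integrableOn_cube' (continuous_const.mul hE) S
  have up : ∫ x in cube n S, h x * Real.exp (-f x) ≤ ∫ x in cube n S, M * Real.exp (-f x) :=
    setIntegral_mono ih iM fun x => mul_le_mul_of_nonneg_right (abs_le.mp (hM x)).2 (Real.exp_pos _).le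
  have dn : ∫ x in cube n S, -M * Real.exp (-f x) ≤ ∫ x in cube n S, h x * Real.exp (-f x) :=
    setIntegral_mono iM' ih fun x => mul_le_mul_of_nonneg_right (abs_le.mp (hM x)).1 (Real.exp_pos _).le
  rw [integral_const_mul] at up dn
  unfold cubeMean
  rw [abs_le, le_div_iff₀ hZ, div_le_iff₀ hZ]
  unfold cubeMass at hZ ⊢
  constructor <;> linarith

/-- A `merge`-composite of a `B`-measurable insert is `B`-measurable. [cite: FriedliVelenik2017, Lemma 6.3] -/
theorem dependsOn_comp_merge {F : (Fin n → ℝ) → ℝ} {B : Set (Fin n)} (hF : DependsOn F B) (lab : Fin n → Fin 3)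
    (x : Fin n → ℝ) : DependsOn (fun z => F (merge lab x z)) B := fun z z' h =>
  hF fun i hi => by
    simp only [merge]
    split_ifs
    · rfl
    · exact h i hi

/-- **(W1) THE MAIN TERM IS THE `ℓ¹`-MASS OF THE DIRECTION ON THE INSERT'S SUPPORT**: for a `B`-measurable insert
with `|∇Φ| ≤ 1`, `|⟨∂_w Φ⟩_K| ≤ Σ_{k ∈ B} |w_k|` (`∂_w Φ = Σ_{k∈B} w_k ∂_k Φ`, `|∂_k Φ| ≤ 1`).  With `w = g_xx(z₀)⁻¹
∇G(z₀)`, `∇G(z₀)` supported in `B_r(j)` and `d(B, j) > s₀ + r`, this is where the Combes–Thomas decay of the inverse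
child Hessian is fed (§7, `ell1_far_le`, via the tree's `combesThomas_banded`). [cite: CombesThomas1973, §II; Spivak1965, Thm 2-7; FriedliVelenik2017, Lemma 6.3] -/
theorem abs_cubeMean_dD_le {S : ℝ} (hS : 0 < S) {g Φ : (Fin n → ℝ) → ℝ} (hg : Continuous g) (hΦ : ContDiff ℝ 1 Φ)
    (hΦ1 : ∀ z, coordGradient Φ z ⬝ᵥ coordGradient Φ z ≤ 1) {B : Finset (Fin n)}
    (hΦd : DependsOn Φ (↑B : Set (Fin n))) (w : Fin n → ℝ) :
    |cubeMean g S (dD Φ w)| ≤ ∑ k ∈ B, |w k| := by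
  refine abs_cubeMean_le hS hg (continuous_dD hΦ w) fun z => ?_
  rw [dD_eq_sum]
  have hz : ∀ k, k ∉ B → coordGradient Φ z k = 0 := fun k hk =>
    coordGradient_eq_zero_of_dependsOn hΦd (fun h => hk (Finset.mem_coe.mp h)) z
  have h1 : ∀ k, |coordGradient Φ z k| ≤ 1 := fun k => by
    have hsq : coordGradient Φ z k * coordGradient Φ z k ≤ 1 :=
      (Finset.single_le_sum (fun i _ => mul_self_nonneg (coordGradient Φ z i)) (Finset.mem_univ k)).trans (hΦ1 z)
    exact abs_le_one_iff_mul_self_le_one.mpr hsq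
  rw [← Finset.sum_subset (Finset.subset_univ B) (fun k _ hk => by rw [hz k hk, mul_zero])]
  refine (Finset.abs_sum_le_sum_abs _ _).trans (Finset.sum_le_sum fun k _ => ?_)
  rw [abs_mul]
  exact mul_le_of_le_one_right (abs_nonneg _) (h1 k)

/-- **THE SEED FROM TWO UNIFORM INPUTS over a class `P ⊆ {RowOsc ε}` (PROVED REDUCTION; (W1) and (W3) discharged to
the direction `w`).**  If for every exact child triple of a `P`-parent at separation `s₀` some direction `w` with
`g_xx(z₀) w = ∇G(z₀)` has `Σ_{k∈B} |w_k| + |Wall_w(Φ − ⟨Φ⟩_K)| + λ⁻¹ (C⁻¹ + Σ_k |w_k|) ε ≤ ρ ∕ (c A q)` — `ℓ¹`-mass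
on the far support `B` (Combes–Thomas), WALL TERM, perturbative term — then `c A q κ^E_P(s₀) ≤ ρ`.
[cite: BrascampLieb1976, Thm 4.1; GlimmJaffe1987, §9.1 (9.1.32), Cor. 4.3.4 (proof); Martinelli1999, §2.4 p.103 (Def. 2.6, Thm 2.7); CombesThomas1973, §II; HelfferSjostrand1994] -/
theorem kappaE_seed_of_wall {ε : ℝ} (hε : 0 ≤ ε) (hPε : ∀ f, P f → RowOsc ε f) {s₀ : ℕ} {A q ρ : ℝ}
    (hA : 0 < A) (hq : 0 < q) (hρ : 0 ≤ ρ)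
    (h : ∀ (lab : Fin n → Fin 3) (f f₁ f₂ : (Fin n → ℝ) → ℝ) (C : ℝ) (x : Fin n → ℝ) (j : Fin n)
      (F : (Fin n → ℝ) → ℝ) (B : Finset (Fin n)),
      𝔖.SideData lab f f₁ f₂ C → x ∈ cube n 𝔖.S → lab j = 1 → P f → P (condPot lab 𝔖.lam f₁ x) → 𝔖.Obs F B →
        (∀ i ∈ B, lab i = 0) → (∀ i ∈ B, s₀ + 𝔖.r < 𝔖.d i j) →
        ∃ (w z₀ : Fin n → ℝ),
          coordHessian (condPot lab 𝔖.lam f₁ x) z₀ *ᵥ w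
            = coordGradient (fun z => C⁻¹ * coordGradient f₁ (merge lab x z) j) z₀ ∧
          (∑ k ∈ B, |w k|)
            + |wallDefect (condPot lab 𝔖.lam f₁ x) 𝔖.S w (fun z => F (merge lab x z)
                - cubeMean (condPot lab 𝔖.lam f₁ x) 𝔖.S (fun z => F (merge lab x z)))|
            + 𝔖.lam⁻¹ * (C⁻¹ + ∑ k, |w k|) * ε ≤ ρ / (𝔖.cst * A * q)) :
    𝔖.cst * A * q * kappaE 𝔖 P s₀ ≤ ρ := by
  refine kappaE_seed_of_stein 𝔖 P hε hPε hA hq hρ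
    fun lab f f₁ f₂ C x j F B hD hx hj hPf hPc hF hB0 hB1 => ?_
  obtain ⟨w, z₀, hw, hsum⟩ := h lab f f₁ f₂ C x j F B hD hx hj hPf hPc hF hB0 hB1
  obtain ⟨hgc2, -, -, -⟩ := 𝔖.inClass_condPot hD x
  obtain ⟨hFc, hFg, hFd, -⟩ := hF
  have hw1 : 0 ≤ ∑ k, |w k| := Finset.sum_nonneg fun k _ => abs_nonneg _
  refine ⟨w, z₀, (∑ k, |w k|) * ε, mul_nonneg hw1 hε, hw,
    fun z _ => hessian_mulVec_osc (hPε _ hPc) w z z₀, ?_⟩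
  have hmain := abs_cubeMean_dD_le 𝔖.S_pos hgc2.continuous (Φ := fun z => F (merge lab x z))
    (hFc.comp (contDiff_merge_right lab x))
    (fun z => (gradSq_comp_merge_le lab (hFc.differentiable one_ne_zero) x z).trans (hFg _))
    (dependsOn_comp_merge hFd lab x) w
  have e : 𝔖.lam⁻¹ * (C⁻¹ * ε + (∑ k, |w k|) * ε) = 𝔖.lam⁻¹ * (C⁻¹ + ∑ k, |w k|) * ε := by ring
  rw [e]
  linarith

end Discharge

/-! ## §7 Discharging (W1) by the COMBES–THOMAS decay of the inverse child Hessian (tree `combesThomas_banded`) and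
(W3) by the BANDED row oscillation — both uniformly in `n`; the final form of the seed reduction -/

section CombesThomas

variable (𝔖 : Spec n) (P : ((Fin n → ℝ) → ℝ) → Prop)

open Literature.Analysis.OperatorTheory (combesThomas_banded)

/-- Entries of a matrix whose columns have `ℓ²`-length `≤ R` are `≤ R` in modulus. [cite: HornJohnson2013, Thm 5.1.4 (Cauchy–Schwarz)] -/
private theorem abs_entry_le {H : Matrix (Fin n) (Fin n) ℝ} {R : ℝ} (hR : 0 ≤ R)
    (h : ∀ k, (fun i => H i k) ⬝ᵥ (fun i => H i k) ≤ R ^ 2) (i k : Fin n) : |H i k| ≤ R := by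
  have h1 : H i k ^ 2 ≤ (fun i => H i k) ⬝ᵥ (fun i => H i k) := by
    rw [sq]
    exact Finset.single_le_sum (f := fun i' => H i' k * H i' k) (fun i' _ => mul_self_nonneg (H i' k))
      (Finset.mem_univ i)
  exact abs_le_of_sq_le_sq (h1.trans (h k)) hR

/-- The Hessian columns of `g` are the rows `∇∂_k g` (as vectors). [cite: Spivak1965, Thm 2-7] -/
theorem coordGradient_coordGradient_eq_col (g : (Fin n → ℝ) → ℝ) (y : Fin n → ℝ) (k : Fin n) :
    coordGradient (fun y => coordGradient g y k) y = fun i => coordHessian g y i k :=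
  funext fun i => coordGradient_coordGradient_eq g y i k

/-- **COMBES–THOMAS FOR THE HESSIAN OF A CLASS MEMBER (by name from the tree).**  For `g ∈ 𝔐` (range `r ≥ 1`,
`g_xx ≥ λ`, Hessian rows `≤ R`, `#B_r ≤ a`) and `μ ≥ 0` with `R a (e^μ − 1) ≤ λ∕2`, every solution of
`g_xx(z₀) v = e_{k₀}` satisfies `|v_i| ≤ (2∕λ) e^{−μ d(i,k₀)∕r}` — the tree's `combesThomas_banded` for the
pseudo-distance `d∕r`. [cite: CombesThomas1973, §II] -/
theorem ct_hessian (hr : 0 < 𝔖.r) {g : (Fin n → ℝ) → ℝ} (hg : 𝔖.InClass g) (z₀ : Fin n → ℝ) {μ : ℝ}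
    (hμ : 0 ≤ μ) (hsmall : 𝔖.R * 𝔖.a * (Real.exp μ - 1) ≤ 𝔖.lam / 2) (k₀ : Fin n) (v : Fin n → ℝ)
    (hv : coordHessian g z₀ *ᵥ v = Pi.single k₀ 1) (i : Fin n) :
    |v i| ≤ 2 / 𝔖.lam * Real.exp (-(μ * ((𝔖.d i k₀ : ℝ) / 𝔖.r))) := by
  obtain ⟨hgc, hB, hloc, hrow⟩ := hg
  have hr' : (0 : ℝ) < 𝔖.r := by exact_mod_cast hr
  have key := combesThomas_banded (coordHessian g z₀) (fun i k => (𝔖.d i k : ℝ) / 𝔖.r) 𝔖.lam 𝔖.R 𝔖.a μ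
    𝔖.lam_pos hμ
    (fun i => by rw [𝔖.d_self, Nat.cast_zero, zero_div])
    (fun i k => by rw [𝔖.d_comm])
    (fun i j k => by
      rw [← add_div]
      exact div_le_div_of_nonneg_right (by exact_mod_cast 𝔖.d_tri i j k) hr'.le)
    (fun i k hik => by
      have hik' : 𝔖.r < 𝔖.d i k := by
        have h1 : (1 : ℝ) < (𝔖.d i k : ℝ) / 𝔖.r := hik
        rw [lt_div_iff₀ hr', one_mul] at h1
        exact_mod_cast h1
      rw [← coordGradient_coordGradient_eq]
      exact coordGradient_eq_zero_of_dependsOn (hloc k) (fun h => by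
        have := 𝔖.mem_ball.mp (Finset.mem_coe.mp h)
        omega) z₀)
    𝔖.R_pos.le
    (fun i k _ => abs_entry_le 𝔖.R_pos.le (fun k => by
        have h1 := hrow k z₀
        rw [coordGradient_coordGradient_eq_col] at h1
        exact h1) i k)
    (fun i => by
      have hsub : (Finset.univ.filter fun k => k ≠ i ∧ (𝔖.d i k : ℝ) / 𝔖.r ≤ 1) ⊆ 𝔖.ball 𝔖.r i := by
        intro k hk
        rw [Finset.mem_filter] at hk
        rw [𝔖.mem_ball, 𝔖.d_comm]
        have h2 : (𝔖.d i k : ℝ) / 𝔖.r ≤ 1 := hk.2.2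
        rw [div_le_iff₀ hr', one_mul] at h2
        exact_mod_cast h2
      exact_mod_cast (Finset.card_le_card hsub).trans (𝔖.card_ball_le_a i))
    (hB z₀) hsmall k₀ v hv i
  exact key

/-- **FAR ENTRIES OF THE SOLVING DIRECTION DECAY**: for `g ∈ 𝔐`, `g_xx(z₀) w = u` with `u` supported in `B_r(j)` and
`|u_i| ≤ 1`, every coordinate `k` with `d(k, j) > s₀ + r` has `|w_k| ≤ a (2∕λ) e^{−μ s₀∕r}` (`w = Σ_i u_i g_xx(z₀)⁻¹ e_i`,
Combes–Thomas per column, `d(k,i) ≥ d(k,j) − r > s₀`, `#B_r(j) ≤ a`). [cite: CombesThomas1973, §II; HornJohnson2013, §0.5 (nonsingularity and the inverse)] -/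
theorem abs_dir_le_far (hr : 0 < 𝔖.r) {g : (Fin n → ℝ) → ℝ} (hg : 𝔖.InClass g) (z₀ : Fin n → ℝ) {μ : ℝ}
    (hμ : 0 ≤ μ) (hsmall : 𝔖.R * 𝔖.a * (Real.exp μ - 1) ≤ 𝔖.lam / 2) {u w : Fin n → ℝ}
    (hw : coordHessian g z₀ *ᵥ w = u) (j : Fin n) (hu0 : ∀ i, i ∉ 𝔖.ball 𝔖.r j → u i = 0)
    (hu1 : ∀ i, |u i| ≤ 1) {s₀ : ℕ} {k : Fin n} (hk : s₀ + 𝔖.r < 𝔖.d k j) :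
    |w k| ≤ 𝔖.a * (2 / 𝔖.lam * Real.exp (-(μ * ((s₀ : ℝ) / 𝔖.r)))) := by
  have hdet : IsUnit (coordHessian g z₀).det :=
    (Matrix.isUnit_iff_isUnit_det _).mp (posDef_of_hessianBound hg.1 𝔖.lam_pos hg.2.1 z₀).isUnit
  have hw' : w = (coordHessian g z₀)⁻¹ *ᵥ u := by
    rw [← hw, mulVec_mulVec, nonsing_inv_mul _ hdet, one_mulVec]
  have hcol : ∀ i, coordHessian g z₀ *ᵥ (fun k => (coordHessian g z₀)⁻¹ k i) = Pi.single i 1 := by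
    intro i
    funext k
    have h1 := congrFun (congrFun (mul_nonsing_inv (coordHessian g z₀) hdet) k) i
    rw [Matrix.mul_apply, Matrix.one_apply] at h1
    simp only [mulVec, dotProduct]
    rw [h1, Pi.single_apply]
  have hct : ∀ i, |(coordHessian g z₀)⁻¹ k i| ≤ 2 / 𝔖.lam * Real.exp (-(μ * ((𝔖.d k i : ℝ) / 𝔖.r))) :=
    fun i => ct_hessian 𝔖 hr hg z₀ hμ hsmall i (fun k => (coordHessian g z₀)⁻¹ k i) (hcol i) k
  have hr' : (0 : ℝ) < 𝔖.r := by exact_mod_cast hr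
  have hl : 0 ≤ 2 / 𝔖.lam := div_nonneg zero_le_two 𝔖.lam_pos.le
  rw [hw']
  simp only [mulVec, dotProduct]
  rw [← Finset.sum_subset (Finset.subset_univ (𝔖.ball 𝔖.r j)) (fun i _ hi => by rw [hu0 i hi, mul_zero])]
  calc |∑ i ∈ 𝔖.ball 𝔖.r j, (coordHessian g z₀)⁻¹ k i * u i|
      ≤ ∑ i ∈ 𝔖.ball 𝔖.r j, |(coordHessian g z₀)⁻¹ k i * u i| := Finset.abs_sum_le_sum_abs _ _
    _ ≤ ∑ i ∈ 𝔖.ball 𝔖.r j, 2 / 𝔖.lam * Real.exp (-(μ * ((s₀ : ℝ) / 𝔖.r))) := by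
        refine Finset.sum_le_sum fun i hi => ?_
        rw [abs_mul]
        have hdi : (s₀ : ℝ) / 𝔖.r ≤ (𝔖.d k i : ℝ) / 𝔖.r := by
          apply div_le_div_of_nonneg_right _ hr'.le
          have h1 := 𝔖.d_tri k i j
          have h2 : 𝔖.d i j ≤ 𝔖.r := 𝔖.mem_ball.mp hi
          exact_mod_cast (by omega : s₀ ≤ 𝔖.d k i)
        have hexp : Real.exp (-(μ * ((𝔖.d k i : ℝ) / 𝔖.r))) ≤ Real.exp (-(μ * ((s₀ : ℝ) / 𝔖.r))) :=
          Real.exp_le_exp.mpr (neg_le_neg (mul_le_mul_of_nonneg_left hdi hμ))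
        calc |(coordHessian g z₀)⁻¹ k i| * |u i|
            ≤ 2 / 𝔖.lam * Real.exp (-(μ * ((𝔖.d k i : ℝ) / 𝔖.r))) * 1 :=
              mul_le_mul (hct i) (hu1 i) (abs_nonneg _) (by positivity)
          _ ≤ 2 / 𝔖.lam * Real.exp (-(μ * ((s₀ : ℝ) / 𝔖.r))) := by
              rw [mul_one]; exact mul_le_mul_of_nonneg_left hexp hl
    _ = (𝔖.ball 𝔖.r j).card * (2 / 𝔖.lam * Real.exp (-(μ * ((s₀ : ℝ) / 𝔖.r)))) := by
        rw [Finset.sum_const, nsmul_eq_mul]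
    _ ≤ 𝔖.a * (2 / 𝔖.lam * Real.exp (-(μ * ((s₀ : ℝ) / 𝔖.r)))) := by
        have h1 : ((𝔖.ball 𝔖.r j).card : ℝ) ≤ 𝔖.a := by exact_mod_cast 𝔖.card_ball_le_a j
        have h2 : 0 ≤ 2 / 𝔖.lam * Real.exp (-(μ * ((s₀ : ℝ) / 𝔖.r))) := by positivity
        exact mul_le_mul_of_nonneg_right h1 h2

/-- The gradient of the partner in its `f₁`-form: `∇(C⁻¹ ∂_j f₁ ∘ merge_x)(z)_i = C⁻¹ · 1[lab i ≠ 1] · ∂_i∂_j f₁(merge_x z)`.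
[cite: Spivak1965, Thm 2-2 (chain rule); FriedliVelenik2017, Lemma 6.7 (6.7)] -/
theorem coordGradient_partner' {lab : Fin n → Fin 3} {f f₁ f₂ : (Fin n → ℝ) → ℝ} {C : ℝ}
    (hD : 𝔖.SideData lab f f₁ f₂ C) (x : Fin n → ℝ) (j : Fin n) (z : Fin n → ℝ) (i : Fin n) :
    coordGradient (fun z => C⁻¹ * coordGradient f₁ (merge lab x z) j) z i
      = C⁻¹ * (if lab i ≠ 1 then coordGradient (fun y => coordGradient f₁ y j) (merge lab x z) i else 0) := by
  have h1 : ContDiff ℝ 1 (fun y => coordGradient f₁ y j) := contDiff_one_coordGradient hD.cd₁ j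
  have hd : Differentiable ℝ (fun y => coordGradient f₁ y j) := h1.differentiable one_ne_zero
  have hdm : Differentiable ℝ (fun z => coordGradient f₁ (merge lab x z) j) :=
    hd.comp ((contDiff_merge_right lab x (m := 1)).differentiable one_ne_zero)
  rw [coordGradient_const_mul hdm C⁻¹ z, Pi.smul_apply, smul_eq_mul, coordGradient_comp_merge_right lab hd x z i]

/-- **The partner's gradient is supported in `B_r(j)`** (the shell partial `∂_j f₁` is a function of `B_r(j)`).
[cite: FriedliVelenik2017, Lemma 6.7 (6.7)] -/
theorem partner_grad_support {lab : Fin n → Fin 3} {f f₁ f₂ : (Fin n → ℝ) → ℝ} {C : ℝ}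
    (hD : 𝔖.SideData lab f f₁ f₂ C) (x : Fin n → ℝ) {j : Fin n} (hj : lab j = 1) (z : Fin n → ℝ) {i : Fin n}
    (hi : i ∉ 𝔖.ball 𝔖.r j) : coordGradient (fun z => C⁻¹ * coordGradient f₁ (merge lab x z) j) z i = 0 := by
  rw [coordGradient_partner' 𝔖 hD x j z i]
  split_ifs
  · rw [coordGradient_eq_zero_of_dependsOn (hD.shell_dep j hj) (fun h => hi (Finset.mem_coe.mp h)) _, mul_zero]
  · rw [mul_zero]

/-- **The partner's gradient has entries `≤ 1`** (`|∇∂_j f₁| ≤ C`, normalised by `C⁻¹`). [cite: HornJohnson2013, Thm 5.1.4 (Cauchy–Schwarz); BrascampLieb1976, Thm 4.1] -/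
theorem partner_grad_abs_le {lab : Fin n → Fin 3} {f f₁ f₂ : (Fin n → ℝ) → ℝ} {C : ℝ}
    (hD : 𝔖.SideData lab f f₁ f₂ C) (x : Fin n → ℝ) {j : Fin n} (hj : lab j = 1) (z : Fin n → ℝ) (i : Fin n) :
    |coordGradient (fun z => C⁻¹ * coordGradient f₁ (merge lab x z) j) z i| ≤ 1 := by
  rw [coordGradient_partner' 𝔖 hD x j z i]
  have hC := hD.C_pos
  have hrow := hD.shell_row j hj (merge lab x z)
  rw [coordGradient_coordGradient_eq_col] at hrow
  have hent : |coordHessian f₁ (merge lab x z) i j| ≤ C := abs_entry_le hC.le (fun _ => hrow) i j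
  split_ifs
  · rw [coordGradient_coordGradient_eq, abs_mul, abs_of_pos (inv_pos.mpr hC)]
    calc C⁻¹ * |coordHessian f₁ (merge lab x z) i j| ≤ C⁻¹ * C :=
          mul_le_mul_of_nonneg_left hent (inv_nonneg.mpr hC.le)
      _ = 1 := inv_mul_cancel₀ hC.ne'
  · rw [mul_zero, abs_zero]; exact zero_le_one

/-- **(W1) DISCHARGED: the `ℓ¹`-mass of the solving direction on a far support is Combes–Thomas small.**  For a
child `g ∈ 𝔐` (range `r ≥ 1`), the partner `G = C⁻¹∂_j f₁ ∘ merge_x` of one-sided data, `g_xx(z₀) w = ∇G(z₀)`, and an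
insert support `B` with `#B ≤ a` and `d(B, j) > s₀ + r`:  `Σ_{k∈B} |w_k| ≤ a² (2∕λ) e^{−μ s₀∕r}` whenever
`R a (e^μ − 1) ≤ λ∕2`. [cite: CombesThomas1973, §II; Martinelli1999, §2.4 p.103 (Def. 2.6)] -/
theorem ell1_far_le {lab : Fin n → Fin 3} {f f₁ f₂ : (Fin n → ℝ) → ℝ} {C : ℝ} (hD : 𝔖.SideData lab f f₁ f₂ C)
    (hr : 0 < 𝔖.r) {μ : ℝ} (hμ : 0 ≤ μ) (hsmall : 𝔖.R * 𝔖.a * (Real.exp μ - 1) ≤ 𝔖.lam / 2)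
    (x : Fin n → ℝ) {j : Fin n} (hj : lab j = 1) {w z₀ : Fin n → ℝ}
    (hw : coordHessian (condPot lab 𝔖.lam f₁ x) z₀ *ᵥ w
      = coordGradient (fun z => C⁻¹ * coordGradient f₁ (merge lab x z) j) z₀)
    {B : Finset (Fin n)} (hBa : B.card ≤ 𝔖.a) {s₀ : ℕ} (hB1 : ∀ k ∈ B, s₀ + 𝔖.r < 𝔖.d k j) :
    ∑ k ∈ B, |w k| ≤ (𝔖.a : ℝ) ^ 2 * (2 / 𝔖.lam * Real.exp (-(μ * ((s₀ : ℝ) / 𝔖.r)))) := by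
  have hg : 𝔖.InClass (condPot lab 𝔖.lam f₁ x) := 𝔖.inClass_condPot hD x
  have hfar : ∀ k ∈ B, |w k| ≤ 𝔖.a * (2 / 𝔖.lam * Real.exp (-(μ * ((s₀ : ℝ) / 𝔖.r)))) := fun k hk =>
    abs_dir_le_far 𝔖 hr hg z₀ hμ hsmall hw j (fun i hi => partner_grad_support 𝔖 hD x hj z₀ hi)
      (fun i => partner_grad_abs_le 𝔖 hD x hj z₀ i) (hB1 k hk)
  have h2 : 0 ≤ 2 / 𝔖.lam * Real.exp (-(μ * ((s₀ : ℝ) / 𝔖.r))) := by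
    have := 𝔖.lam_pos; positivity
  calc ∑ k ∈ B, |w k| ≤ ∑ k ∈ B, (𝔖.a : ℝ) * (2 / 𝔖.lam * Real.exp (-(μ * ((s₀ : ℝ) / 𝔖.r)))) :=
        Finset.sum_le_sum hfar
    _ = B.card * ((𝔖.a : ℝ) * (2 / 𝔖.lam * Real.exp (-(μ * ((s₀ : ℝ) / 𝔖.r))))) := by
        rw [Finset.sum_const, nsmul_eq_mul]
    _ ≤ 𝔖.a * ((𝔖.a : ℝ) * (2 / 𝔖.lam * Real.exp (-(μ * ((s₀ : ℝ) / 𝔖.r))))) := by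
        have h1 : (B.card : ℝ) ≤ 𝔖.a := by exact_mod_cast hBa
        exact mul_le_mul_of_nonneg_right h1 (by positivity)
    _ = (𝔖.a : ℝ) ^ 2 * (2 / 𝔖.lam * Real.exp (-(μ * ((s₀ : ℝ) / 𝔖.r)))) := by ring

/-- **DIRECTIONS ARE `λ⁻¹`-SHORT**: `g_xx ≥ λ`, `g_xx(z₀) w = u`, `|u|₂ ≤ 1` ⇒ `λ² |w|₂² ≤ 1` (no square roots:
`λ|w|² ≤ w·u` and `0 ≤ |λw − u|²`). [cite: HornJohnson2013, Thm 5.1.4 (Cauchy–Schwarz); BrascampLieb1976, Thm 4.1] -/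
theorem sq_dir_le {lam : ℝ} (hlam : 0 < lam) {g : (Fin n → ℝ) → ℝ} (hB : HessianBound g lam) (z₀ : Fin n → ℝ)
    {u w : Fin n → ℝ} (hw : coordHessian g z₀ *ᵥ w = u) (hu : u ⬝ᵥ u ≤ 1) : lam ^ 2 * (w ⬝ᵥ w) ≤ 1 := by
  have h1 : lam * (w ⬝ᵥ w) ≤ w ⬝ᵥ u := by rw [← hw]; exact hB z₀ w
  have h2 : 0 ≤ (lam • w - u) ⬝ᵥ (lam • w - u) := Finset.sum_nonneg fun i _ => mul_self_nonneg _
  rw [sub_dotProduct, dotProduct_sub, dotProduct_sub, smul_dotProduct, dotProduct_smul, dotProduct_smul,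
    smul_dotProduct, smul_eq_mul, smul_eq_mul, smul_eq_mul, smul_eq_mul, dotProduct_comm u w] at h2
  have h3 : lam * (lam * (w ⬝ᵥ w)) ≤ lam * (w ⬝ᵥ u) := mul_le_mul_of_nonneg_left h1 hlam.le
  rw [sq, mul_assoc]
  linarith

/-- **BANDED CAUCHY–SCHWARZ**: rows `D_i` of `ℓ²`-length `≤ ε` supported in `B_r(i)` (`#B_r ≤ a`) give
`Σ_i (D_i·w)² ≤ a ε² |w|₂²` (Cauchy–Schwarz per row on its support, then `Σ_i Σ_{k ∈ B_r(i)} w_k² = Σ_k #B_r(k) w_k²`).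
[cite: HornJohnson2013, Thm 5.1.4 (Cauchy–Schwarz), §5.6 (Schur's test); Martinelli1999, §2.1 p.98] -/
theorem sum_sq_dotProduct_le_banded {D : Fin n → Fin n → ℝ} {ε : ℝ} (hD2 : ∀ i, D i ⬝ᵥ D i ≤ ε ^ 2)
    (hD0 : ∀ i k, k ∉ 𝔖.ball 𝔖.r i → D i k = 0) (w : Fin n → ℝ) :
    ∑ i, (D i ⬝ᵥ w) ^ 2 ≤ 𝔖.a * ε ^ 2 * (w ⬝ᵥ w) := by
  have hrow : ∀ i, (D i ⬝ᵥ w) ^ 2 ≤ ε ^ 2 * ∑ k ∈ 𝔖.ball 𝔖.r i, w k ^ 2 := by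
    intro i
    have e : D i ⬝ᵥ w = ∑ k ∈ 𝔖.ball 𝔖.r i, D i k * w k :=
      (Finset.sum_subset (Finset.subset_univ _) (fun k _ hk => by rw [hD0 i k hk, zero_mul])).symm
    rw [e]
    calc (∑ k ∈ 𝔖.ball 𝔖.r i, D i k * w k) ^ 2
        ≤ (∑ k ∈ 𝔖.ball 𝔖.r i, D i k ^ 2) * (∑ k ∈ 𝔖.ball 𝔖.r i, w k ^ 2) :=
          Finset.sum_mul_sq_le_sq_mul_sq _ _ _
      _ ≤ ε ^ 2 * ∑ k ∈ 𝔖.ball 𝔖.r i, w k ^ 2 := by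
          apply mul_le_mul_of_nonneg_right _ (Finset.sum_nonneg fun k _ => sq_nonneg _)
          calc ∑ k ∈ 𝔖.ball 𝔖.r i, D i k ^ 2 ≤ ∑ k, D i k ^ 2 :=
                Finset.sum_le_sum_of_subset_of_nonneg (Finset.subset_univ _) (fun k _ _ => sq_nonneg _)
            _ = D i ⬝ᵥ D i := by simp only [dotProduct, sq]
            _ ≤ ε ^ 2 := hD2 i
  have hswap : ∑ i, ∑ k ∈ 𝔖.ball 𝔖.r i, w k ^ 2 ≤ 𝔖.a * (w ⬝ᵥ w) := by
    have e1 : ∀ i, ∑ k ∈ 𝔖.ball 𝔖.r i, w k ^ 2 = ∑ k, if 𝔖.d k i ≤ 𝔖.r then w k ^ 2 else 0 := fun i => by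
      rw [Spec.ball, Finset.sum_filter]
    simp_rw [e1]
    rw [Finset.sum_comm]
    have e2 : ∀ k, ∑ i, (if 𝔖.d k i ≤ 𝔖.r then w k ^ 2 else 0) = ((𝔖.ball 𝔖.r k).card : ℝ) * w k ^ 2 := by
      intro k
      have e3 : (Finset.univ.filter fun i => 𝔖.d k i ≤ 𝔖.r) = 𝔖.ball 𝔖.r k := by
        ext i
        simp only [Finset.mem_filter, Finset.mem_univ, true_and, Spec.mem_ball, 𝔖.d_comm k i]
      rw [← Finset.sum_filter, Finset.sum_const, nsmul_eq_mul, e3]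
    simp_rw [e2]
    calc ∑ k, ((𝔖.ball 𝔖.r k).card : ℝ) * w k ^ 2 ≤ ∑ k, (𝔖.a : ℝ) * w k ^ 2 :=
          Finset.sum_le_sum fun k _ =>
            mul_le_mul_of_nonneg_right (by exact_mod_cast 𝔖.card_ball_le_a k) (sq_nonneg _)
      _ = 𝔖.a * (w ⬝ᵥ w) := by rw [← Finset.mul_sum]; simp only [dotProduct, sq]
  calc ∑ i, (D i ⬝ᵥ w) ^ 2 ≤ ∑ i, ε ^ 2 * ∑ k ∈ 𝔖.ball 𝔖.r i, w k ^ 2 := Finset.sum_le_sum fun i _ => hrow i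
    _ = ε ^ 2 * ∑ i, ∑ k ∈ 𝔖.ball 𝔖.r i, w k ^ 2 := by rw [Finset.mul_sum]
    _ ≤ ε ^ 2 * (𝔖.a * (w ⬝ᵥ w)) := mul_le_mul_of_nonneg_left hswap (sq_nonneg _)
    _ = 𝔖.a * ε ^ 2 * (w ⬝ᵥ w) := by ring

/-- **(W3), UNIFORM FORM**: for `g ∈ 𝔐` with `RowOsc ε g` the Hessian difference `g_xx(z) − g_xx(z')` is banded
(range `r`) with rows of length `≤ ε`, so `|(g_xx(z) − g_xx(z')) w|₂² ≤ a ε² |w|₂²` — volume-free, unlike the crude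
`ℓ¹` form `hessian_mulVec_osc`. [cite: HornJohnson2013, §5.6 (Schur's test); Spivak1965, Thm 2-5; Ledoux2001, Prop. 6.2 p.190] -/
theorem hessian_mulVec_osc_banded {ε : ℝ} {g : (Fin n → ℝ) → ℝ} (hg : 𝔖.InClass g) (hR : RowOsc ε g)
    (w z z' : Fin n → ℝ) :
    ((coordHessian g z - coordHessian g z') *ᵥ w) ⬝ᵥ ((coordHessian g z - coordHessian g z') *ᵥ w)
      ≤ 𝔖.a * ε ^ 2 * (w ⬝ᵥ w) := by
  obtain ⟨hgc, -, hloc, -⟩ := hg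
  set D : Fin n → Fin n → ℝ := fun i =>
    coordGradient (fun y => coordGradient g y i) z - coordGradient (fun y => coordGradient g y i) z' with hD
  have e : (coordHessian g z - coordHessian g z') *ᵥ w = fun i => D i ⬝ᵥ w := by
    funext i
    simp only [mulVec, dotProduct, hD, Pi.sub_apply, Matrix.sub_apply]
    refine Finset.sum_congr rfl fun k _ => ?_
    rw [coordGradient_coordGradient_comm hgc z k i, coordGradient_coordGradient_comm hgc z' k i,
      coordGradient_coordGradient_eq, coordGradient_coordGradient_eq]
  have h0 : ∀ i k, k ∉ 𝔖.ball 𝔖.r i → D i k = 0 := by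
    intro i k hk
    have hz : ∀ y, coordGradient (fun y => coordGradient g y i) y k = 0 := fun y =>
      coordGradient_eq_zero_of_dependsOn (hloc i) (fun h => hk (Finset.mem_coe.mp h)) y
    simp only [hD, Pi.sub_apply, hz, sub_zero]
  rw [e]
  calc (fun i => D i ⬝ᵥ w) ⬝ᵥ (fun i => D i ⬝ᵥ w) = ∑ i, (D i ⬝ᵥ w) ^ 2 := by simp only [dotProduct, sq]
    _ ≤ 𝔖.a * ε ^ 2 * (w ⬝ᵥ w) := sum_sq_dotProduct_le_banded 𝔖 (fun i => hR i z z') h0 w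

/-- **(W3) DISCHARGED UNIFORMLY**: for a `P ⊆ {RowOsc ε}` child `g = condPot` of one-sided data and the solving
direction `g_xx(z₀) w = ∇G(z₀)` of the gradient partner (`|∇G| ≤ 1`, so `λ²|w|² ≤ 1`), the Hessian-oscillation radius
along `w` is `δ_H = a ε ∕ λ`: `|(g_xx(z) − g_xx(z₀)) w|² ≤ a ε²|w|² ≤ a ε²∕λ² ≤ (a ε∕λ)²`. [cite: BrascampLieb1976, Thm 4.1; HornJohnson2013, §5.6 (Schur's test); Ledoux2001, Prop. 6.2 p.190] -/
theorem hessian_dir_osc_le {lab : Fin n → Fin 3} {f f₁ f₂ : (Fin n → ℝ) → ℝ} {C : ℝ} (hD : 𝔖.SideData lab f f₁ f₂ C)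
    (x : Fin n → ℝ) {ε : ℝ} (hRx : RowOsc ε (condPot lab 𝔖.lam f₁ x)) {j : Fin n} (hj : lab j = 1) {m : ℕ}
    {F : (Fin n → ℝ) → ℝ} {B : Finset (Fin n)} (hF : 𝔖.Obs F B) (hB1 : ∀ i ∈ B, m + 𝔖.r < 𝔖.d i j)
    {w z₀ : Fin n → ℝ} (hw : coordHessian (condPot lab 𝔖.lam f₁ x) z₀ *ᵥ w
      = coordGradient (fun z => C⁻¹ * coordGradient f₁ (merge lab x z) j) z₀) (z : Fin n → ℝ) :
    ((coordHessian (condPot lab 𝔖.lam f₁ x) z - coordHessian (condPot lab 𝔖.lam f₁ x) z₀) *ᵥ w)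
      ⬝ᵥ ((coordHessian (condPot lab 𝔖.lam f₁ x) z - coordHessian (condPot lab 𝔖.lam f₁ x) z₀) *ᵥ w)
      ≤ (𝔖.a * ε / 𝔖.lam) ^ 2 := by
  have hg : 𝔖.InClass (condPot lab 𝔖.lam f₁ x) := 𝔖.inClass_condPot hD x
  obtain ⟨-, A', B', -, hG, -⟩ := adm_child 𝔖 hD x hj hF hB1
  have hww : 𝔖.lam ^ 2 * (w ⬝ᵥ w) ≤ 1 := sq_dir_le 𝔖.lam_pos hg.2.1 z₀ hw (hG.2.1 z₀)
  have hl0 : 𝔖.lam ≠ 0 := 𝔖.lam_pos.ne'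
  have ha : (𝔖.a : ℝ) ≤ (𝔖.a : ℝ) ^ 2 := by exact_mod_cast Nat.le_self_pow two_ne_zero 𝔖.a
  calc ((coordHessian (condPot lab 𝔖.lam f₁ x) z - coordHessian (condPot lab 𝔖.lam f₁ x) z₀) *ᵥ w)
        ⬝ᵥ ((coordHessian (condPot lab 𝔖.lam f₁ x) z - coordHessian (condPot lab 𝔖.lam f₁ x) z₀) *ᵥ w)
      ≤ 𝔖.a * ε ^ 2 * (w ⬝ᵥ w) := hessian_mulVec_osc_banded 𝔖 hg hRx w z z₀
    _ = 𝔖.a * ε ^ 2 / 𝔖.lam ^ 2 * (𝔖.lam ^ 2 * (w ⬝ᵥ w)) := by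
        rw [div_mul_eq_mul_div, mul_comm (𝔖.lam ^ 2) (w ⬝ᵥ w), ← mul_assoc, mul_div_assoc,
          div_self (pow_ne_zero 2 hl0), mul_one]
    _ ≤ 𝔖.a * ε ^ 2 / 𝔖.lam ^ 2 * 1 := by
        have : 0 ≤ (𝔖.a : ℝ) * ε ^ 2 / 𝔖.lam ^ 2 := by positivity
        exact mul_le_mul_of_nonneg_left hww this
    _ ≤ (𝔖.a : ℝ) ^ 2 * ε ^ 2 / 𝔖.lam ^ 2 := by
        rw [mul_one]
        exact div_le_div_of_nonneg_right (mul_le_mul_of_nonneg_right ha (sq_nonneg ε)) (sq_nonneg _)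
    _ = (𝔖.a * ε / 𝔖.lam) ^ 2 := by rw [div_pow, mul_pow]

/-- **THE SEED FROM THE WALL TERM ALONE (PROVED REDUCTION; (W1) by Combes–Thomas, (W3) by the banded row
oscillation — both UNIFORM in the volume `n`).**  Range `r ≥ 1`, `μ ≥ 0` with `R a (e^μ − 1) ≤ λ∕2`,
`P ⊆ {RowOsc ε}`.  If for every exact child triple of a `P`-parent at separation `s₀` some base point `z₀` and the
solving direction `w` (`g_xx(z₀) w = ∇G(z₀)`; it exists, `exists_dir`) give
`a²(2∕λ) e^{−μ s₀∕r} + |Wall_w(Φ − ⟨Φ⟩_K)| + λ⁻¹ (C⁻¹ + a∕λ) ε ≤ ρ ∕ (c A q)`, then `c A q κ^E_P(s₀) ≤ ρ`.  The first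
summand is made small by `s₀` ALONE, the third by `ε` ALONE (both with constants depending only on `λ, R, r, a`); what
remains is the uniform smallness of THE WALL TERM `Wall_w(Φ̃)` of the hard window — the located obstruction of the
header. [cite: CombesThomas1973, §II; BrascampLieb1976, Thm 4.1; GlimmJaffe1987, §9.1 (9.1.32), Cor. 4.3.4 (proof); Martinelli1999, §2.4 p.103 (Def. 2.6, Thm 2.7); HelfferSjostrand1994; Ledoux2001, Prop. 6.2 p.190] -/
theorem kappaE_seed_of_wallCT (hr : 0 < 𝔖.r) {μ : ℝ} (hμ : 0 ≤ μ)
    (hsmall : 𝔖.R * 𝔖.a * (Real.exp μ - 1) ≤ 𝔖.lam / 2) {ε : ℝ} (hε : 0 ≤ ε) (hPε : ∀ f, P f → RowOsc ε f)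
    {s₀ : ℕ} {A q ρ : ℝ} (hA : 0 < A) (hq : 0 < q) (hρ : 0 ≤ ρ)
    (h : ∀ (lab : Fin n → Fin 3) (f f₁ f₂ : (Fin n → ℝ) → ℝ) (C : ℝ) (x : Fin n → ℝ) (j : Fin n)
      (F : (Fin n → ℝ) → ℝ) (B : Finset (Fin n)),
      𝔖.SideData lab f f₁ f₂ C → x ∈ cube n 𝔖.S → lab j = 1 → P f → P (condPot lab 𝔖.lam f₁ x) → 𝔖.Obs F B →
        (∀ i ∈ B, lab i = 0) → (∀ i ∈ B, s₀ + 𝔖.r < 𝔖.d i j) →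
        ∃ (w z₀ : Fin n → ℝ),
          coordHessian (condPot lab 𝔖.lam f₁ x) z₀ *ᵥ w
            = coordGradient (fun z => C⁻¹ * coordGradient f₁ (merge lab x z) j) z₀ ∧
          (𝔖.a : ℝ) ^ 2 * (2 / 𝔖.lam * Real.exp (-(μ * ((s₀ : ℝ) / 𝔖.r))))
            + |wallDefect (condPot lab 𝔖.lam f₁ x) 𝔖.S w (fun z => F (merge lab x z)
                - cubeMean (condPot lab 𝔖.lam f₁ x) 𝔖.S (fun z => F (merge lab x z)))|
            + 𝔖.lam⁻¹ * (C⁻¹ + 𝔖.a / 𝔖.lam) * ε ≤ ρ / (𝔖.cst * A * q)) :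
    𝔖.cst * A * q * kappaE 𝔖 P s₀ ≤ ρ := by
  refine kappaE_seed_of_stein 𝔖 P hε hPε hA hq hρ
    fun lab f f₁ f₂ C x j F B hD hx hj hPf hPc hF hB0 hB1 => ?_
  obtain ⟨w, z₀, hw, hsum⟩ := h lab f f₁ f₂ C x j F B hD hx hj hPf hPc hF hB0 hB1
  obtain ⟨hgc2, -, -, -⟩ := 𝔖.inClass_condPot hD x
  have hδH : 0 ≤ 𝔖.a * ε / 𝔖.lam := by have := 𝔖.lam_pos; positivity
  refine ⟨w, z₀, 𝔖.a * ε / 𝔖.lam, hδH, hw,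
    fun z _ => hessian_dir_osc_le 𝔖 hD x (hPε _ hPc) hj hF hB1 hw z, ?_⟩
  have hct := ell1_far_le 𝔖 hD hr hμ hsmall x hj hw hF.2.2.2 hB1
  obtain ⟨hFc, hFg, hFd, -⟩ := hF
  have hmain := abs_cubeMean_dD_le 𝔖.S_pos hgc2.continuous (Φ := fun z => F (merge lab x z))
    (hFc.comp (contDiff_merge_right lab x))
    (fun z => (gradSq_comp_merge_le lab (hFc.differentiable one_ne_zero) x z).trans (hFg _))
    (dependsOn_comp_merge hFd lab x) w
  have e : 𝔖.lam⁻¹ * (C⁻¹ * ε + 𝔖.a * ε / 𝔖.lam) = 𝔖.lam⁻¹ * (C⁻¹ + 𝔖.a / 𝔖.lam) * ε := by ring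
  rw [e]
  linarith

end CombesThomas

end Literature.MathematicalPhysics.QuantumFieldTheory.Balaban1983to89.T4CubeShellSteinSeed
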